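import Mathlib
import Literature.NumberTheory.LFunctions.Zhang2022.TypedSection10C
import Literature.NumberTheory.LFunctions.Zhang2022.Section10TruncationBridges
import Literature.NumberTheory.LFunctions.Zhang2022.Section10RangeToolkit
import Literature.NumberTheory.LFunctions.Zhang2022.Section9Ded97
import Literature.NumberTheory.LFunctions.Zhang2022.Section10Lemma101
import Literature.NumberTheory.LFunctions.Zhang2022.SkeletonLemma84Rel
import HarnessLib

/-!
# Zhang (2022) §10c, the low range of `S_j(𝐚₁₄,𝐚₂₂)` is `o(α)` — node `Z22:§10.u049 (i)` as an edge

Topic `Literature/NumberTheory/LFunctions/Zhang2022` (Landau–Siegel audit tree; verdict-neutral).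
Y. Zhang, *Discrete mean estimates and the Landau–Siegel zero*, arXiv:2211.02515v1 (2022)
[Zhang2022LandauSiegel] — **an unrefereed manuscript under adjudication**; this theorem-only file
(campaign siegel-zhang, L3-t8, grant L3 LEDGER #14 (3)) asserts nothing about Theorems 1–2. It
proves the FIRST range claim of the evaluation of `Θ₁(𝐚₁₄,𝐚₂₂)` [Z22 p.59, tex L3027]:

> "By a result similar to Lemma 10.1 and the results in Section 8, the sum over `dr < P^{0.496}`
> is `o(α)`"

(typed by L3-t8 as `Typed.Sec10C.Low1422Small c′`, DAG node `Z22:§10.u049 (i)`) as the EDGE THEOREM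
`low1422Small_of : Skeleton.Lemma101 c′ → Skeleton.Lemma84 c′ → Low1422Small c′`, and — Lemma 10.1
being a theorem of the tree for `c′ ≥ 0` (sz-d45, `Skeleton.lemma101_holds`) — as
`low1422Small_of_lemma84 : 0 ≤ c′ → Skeleton.Lemma84 c′ → Low1422Small c′`. The only remaining
antecedent, Lemma 8.4, is a banked CLAIM leaf of the cone (`Skeleton.Lemma84`, manuscript Appendix A).

## The printed argument, made quantitative

With `n = dr` and the weight `w(d,r) = |χ(d)||μχ(r)|λ₀ⱼ(n)/(nφ(r))`, the summand of
`S1422On c′ χ j 0 P^{0.496}` is `w(d,r)·M(n)·N(d,r)` where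

* `M(n) = Σ_m χ(m)f̃(log(nm)/log P + 0.004 − α̃)m^{β_j−1} = 𝔳₁ⱼ(y*)`, `y* = nP^{0.004}/(Dt₀)` ("a result
  similar to Lemma 10.1": L3-t2's substitution `frakv1S_eq_frakv1` and the truncation bridge
  `Typed.Sec10C.mSum14_eq_frakv1_yShift`). For `1 ≤ n < P^{0.496}` one has `1 ≤ y* ≤ P^{0.5}`; Lemma 10.1
  gives `‖M‖ ≤ CT^{−c}` when `y* ≤ P^{0.5}/T`, i.e. `n ≤ W := P^{0.496}Dt₀/T` ((10.2)), and only
  `‖M‖ ≤ C𝓛⁻⁷` on the window `n > W` ((10.5)), whose logarithmic length is `log T − log(Dt₀) ≤ 𝓛^{1.1}`.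
* `N(d,r) = Σ_n χ(n)(ι₃ conj ϰ₃(drn) + ι₄ conj ϰ₂(drn))ξ₀ⱼ(n;d,r)/n` ("the results in Section 8"): since
  `conj ϰ₃(k) = (log(P₃/k)/log P₃)(P₃/k)^{−β₆}` ((8.6), `β₆ ∈ iℝ`), `N` is EXACTLY
  `(ι₃/log P₃)·Σ⁽⁸·⁴⁾(μ=6, x=P₃/dr) + (ι₄/log P₂)·Σ⁽⁸·⁴⁾(μ=7, x=P₂/dr)` (`nSum22_eq_lemma84_sums`), the
  two sums being those of Lemma 8.4 with `T < x < P`, `dr < PT⁻²`; hence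
  `‖N‖ ≤ (n/φ(n))²·K_N·𝓛⁻⁷` (`norm_nSum22_le`: `|L′(1,χ)| ≤ 4e^{9/2}𝓛²`, `‖Π(d,r)‖ ≤ (n/φ(n))²`,
  `‖𝔤_{jμ}‖ ≤ G₀(c′)`, `log P₃, log P₂ ≥ 0.4𝓛⁹`).
* weights: `‖λ₀ⱼ(n)‖ ≤ (n/φ(n))⁴`, `Σ_{r∣n sqfree} φ(r)⁻¹ = n/φ(n)`, and
  `Σ_{Y<n≤X}(n/φ(n))⁷/n ≤ e²⁵⁶(1 + log X − log Y)` (sz-d41's `Section10RangeToolkit`).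

Altogether `‖S1422On(0,P^{0.496})‖ ≤ C K_N 𝓛⁻⁷[T^{−c}(1 + e²⁵⁶(1 + 𝓛⁹)) + 𝓛⁻⁷e²⁵⁶(3 + 𝓛^{1.1})]`, and
`T^{−c} ≤ e^{−c𝓛}`, `e^{−c𝓛}𝓛¹¹ ≤ 12!/(c¹²𝓛)` make this `≤ εα = επ𝓛⁻⁹` once
`𝓛 ≥ max(5, C K_N e²⁵⁶(3·12!/c¹² + 4)/(επ))`. No new definition, no named fact; standard axioms.

## References

* Y. Zhang, arXiv:2211.02515v1 (2022), §10 p. 59 (evaluation of `Θ₁(𝐚₁₄,𝐚₂₂)`, first range);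
  Lemma 10.1 and (10.2)/(10.5) p. 54; Lemma 8.4 p. 46; (8.6); §2 (2.6), (2.8), (2.21), (2.22), (2.26).
  [cite: Zhang2022LandauSiegel, §10 p. 59]
-/

noncomputable section

open Complex Real ComplexConjugate

namespace Literature.NumberTheory.LFunctions.Zhang2022.Typed.Sec10C

open Literature.NumberTheory.LFunctions.Zhang2022.Skeleton
open Literature.NumberTheory.LFunctions.Zhang2022.Typed.Sec10B

/-! ### Sizes of the parameters (`P = e^{𝓛⁹}`, `T = e^{𝓛^{1.1}}`, `t₀ = 𝓛⁵¹⁹`, `P₂ = P^{0.5}T⁻¹⁰`, `P₃ = P^{0.498}`) -/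

/-- `log D ≥ L` once `D ≥ ⌈e^L⌉`. [folklore] -/
private theorem le_ell_of_ceil_exp_le {L : ℝ} {D : ℕ} (hD : ⌈Real.exp L⌉₊ ≤ D) : L ≤ ell D := by
  rw [ell]
  have hD' : Real.exp L ≤ (D : ℝ) := (Nat.le_ceil _).trans (by exact_mod_cast hD)
  have hpos : (0 : ℝ) < D := (Real.exp_pos L).trans_le hD'
  exact (Real.le_log_iff_exp_le hpos).mpr hD'

/-- `𝓛 ≥ 3 ⇒ D ≥ 2` (as naturals). [folklore] -/
private theorem two_le_of_ell {D : ℕ} (hℓ : 3 ≤ ell D) : 2 ≤ D := by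
  by_contra h
  have h2 : D < 2 := not_le.mp h
  interval_cases D
  · simp [ell] at hℓ; linarith
  · simp [ell] at hℓ; linarith

/-- `𝓛^{1.1} ≤ 𝓛²` for `𝓛 ≥ 1`. [folklore] -/
private theorem ell_rpow_le_sq {D : ℕ} (h1 : 1 ≤ ell D) : ell D ^ (1.1 : ℝ) ≤ ell D ^ 2 := by
  have h : ell D ^ (1.1 : ℝ) ≤ ell D ^ (2 : ℝ) :=
    Real.rpow_le_rpow_of_exponent_le h1 (by norm_num)
  simpa using h

/-- `𝓛 ≤ 𝓛^{1.1}` for `𝓛 ≥ 1`. [folklore] -/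
private theorem ell_le_rpow {D : ℕ} (h1 : 1 ≤ ell D) : ell D ≤ ell D ^ (1.1 : ℝ) := by
  have h : ell D ^ (1 : ℝ) ≤ ell D ^ (1.1 : ℝ) :=
    Real.rpow_le_rpow_of_exponent_le h1 (by norm_num)
  simpa using h

/-- `log T = 𝓛^{1.1}`, `T > 0`. [cite: Zhang2022LandauSiegel, §2 (2.6)] -/
private theorem log_bigT (D : ℕ) : Real.log (bigT D) = ell D ^ (1.1 : ℝ) := by
  rw [bigT, Real.log_exp]

/-- `log P = 𝓛⁹`. [cite: Zhang2022LandauSiegel, §2 (2.6)] -/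
private theorem log_bigP (D : ℕ) : Real.log (bigP D) = ell D ^ 9 := by
  rw [bigP, Real.log_exp]

/-- `log P₃ = 0.498·𝓛⁹`. [cite: Zhang2022LandauSiegel, §2 (2.21)] -/
private theorem log_P3 (D : ℕ) : Real.log (P3 D) = 0.498 * ell D ^ 9 := by
  have hP : 0 < bigP D := Real.exp_pos _
  rw [P3, Real.log_rpow hP, log_bigP]

/-- `log P₂ = 0.5·𝓛⁹ − 10·𝓛^{1.1}`. [cite: Zhang2022LandauSiegel, §2 (2.21)] -/
private theorem log_P2 (D : ℕ) :
    Real.log (Skeleton.P2 D) = 0.5 * ell D ^ 9 - 10 * ell D ^ (1.1 : ℝ) := by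
  have hP : 0 < bigP D := Real.exp_pos _
  have hT : 0 < bigT D := Real.exp_pos _
  rw [Skeleton.P2, Real.log_div (Real.rpow_pos_of_pos hP _).ne' (pow_pos hT _).ne',
    Real.log_rpow hP, log_bigP, Real.log_pow, log_bigT]
  ring

/-- `log(P^a) = a𝓛⁹`. [cite: Zhang2022LandauSiegel, §2 (2.6)] -/
private theorem log_bigP_rpow (D : ℕ) (a : ℝ) : Real.log (bigP D ^ a) = a * ell D ^ 9 := by
  have hP : 0 < bigP D := Real.exp_pos _
  rw [Real.log_rpow hP, log_bigP]

/-- `D·t₀ ≤ e^{520𝓛}` (`D = e^{𝓛}`, `t₀ = 𝓛⁵¹⁹ ≤ e^{519𝓛}`), for `𝓛 ≥ 1`. [cite: Zhang2022LandauSiegel, §2 (2.8)] -/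
private theorem D_mul_t0_le {D : ℕ} (h1 : 1 ≤ ell D) : (D : ℝ) * t0 D ≤ Real.exp (520 * ell D) := by
  have h0 : 0 ≤ ell D := by linarith
  have hD0 : (0 : ℝ) < D := by
    have : 0 < ell D := by linarith
    rw [ell] at this
    by_contra h
    have hD : (D : ℝ) = 0 := le_antisymm (not_lt.mp h) (Nat.cast_nonneg D)
    rw [hD, Real.log_zero] at this
    exact lt_irrefl _ this
  have hDexp : (D : ℝ) = Real.exp (ell D) := by rw [ell, Real.exp_log hD0]
  have ht0 : t0 D ≤ Real.exp (519 * ell D) := by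
    rw [t0, show (519 : ℝ) * ell D = ((519 : ℕ) : ℝ) * ell D by norm_num, Real.exp_nat_mul]
    refine pow_le_pow_left₀ h0 ?_ 519
    have := Real.add_one_le_exp (ell D); linarith
  have ht0' : 0 ≤ t0 D := by rw [t0]; exact pow_nonneg h0 _
  calc (D : ℝ) * t0 D ≤ Real.exp (ell D) * Real.exp (519 * ell D) := by rw [hDexp]; gcongr
    _ = Real.exp (520 * ell D) := by rw [← Real.exp_add]; ring_nf

/-- `1 ≤ D·t₀` for `𝓛 ≥ 1`. [cite: Zhang2022LandauSiegel, §2 (2.8)] -/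
private theorem one_le_D_mul_t0 {D : ℕ} (h1 : 1 ≤ ell D) : 1 ≤ (D : ℝ) * t0 D := by
  have hD1 : (1 : ℝ) ≤ D := by
    have : 0 < ell D := by linarith
    rw [ell] at this
    by_contra h
    have : Real.log (D : ℝ) ≤ 0 := Real.log_nonpos (Nat.cast_nonneg D) (not_le.mp h).le
    linarith
  have ht0 : 1 ≤ t0 D := by rw [t0]; exact one_le_pow₀ h1
  nlinarith

/-! ### The `n`-sum of `S_j(𝐚₁₄,𝐚₂₂)` in terms of the two sums of Lemma 8.4 -/

/-- A purely imaginary shift: `conj β_μ = −β_μ`. [cite: Zhang2022LandauSiegel, §2 (2.22)] -/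
private theorem conj_betaMu (D μ : ℕ) : conj (betaMu D μ) = -betaMu D μ := by
  have h : (betaMu D μ).re = 0 := by
    unfold betaMu beta6 beta7
    split_ifs <;> simp
  apply Complex.ext <;> simp [h]

/-- `conj ϰ₃(k) = (log(P₃/k)/log P₃)·(P₃/k)^{−β₆}` for `1 ≤ k < P₃`; `ϰ₃(k) = 0` for `k ≥ P₃` ((8.6):
`ϰ₃(k) = (1 − log k/log P₃)(P₃/k)^{β₆}`). [cite: Zhang2022LandauSiegel, §8 (8.6)] -/
private theorem conj_vk3 {D k : ℕ} (hP3 : 1 < P3 D) (hk0 : 0 < k) (hk : (k : ℝ) < P3 D) :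
    conj (vk3 D k) =
      ((Real.log (P3 D / k) / Real.log (P3 D) : ℝ) : ℂ) * ((P3 D / k : ℝ) : ℂ) ^ (-betaMu D 6) := by
  have hk0' : (0 : ℝ) < k := by exact_mod_cast hk0
  have hP30 : 0 < P3 D := by linarith
  have hlog : Real.log (P3 D) ≠ 0 := (Real.log_pos hP3).ne'
  have harg : (((P3 D / k : ℝ)) : ℂ).arg ≠ π := by
    rw [Complex.arg_ofReal_of_nonneg (div_pos hP30 hk0').le]; exact Real.pi_ne_zero.symm
  have hβ : -betaMu D 6 = conj (beta6 D) := by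
    rw [show beta6 D = betaMu D 6 by simp [betaMu], conj_betaMu]
  rw [vk3, if_pos hk, map_mul, Complex.conj_ofReal, hβ, Complex.cpow_conj _ _ harg,
    Complex.conj_ofReal]
  congr 2
  rw [Real.log_div hP30.ne' hk0'.ne']
  field_simp

/-- `conj ϰ₂(k) = (log(P₂/k)/log P₂)·(P₂/k)^{−β₇}` for `1 ≤ k < P₂` ((8.6)). [cite: Zhang2022LandauSiegel, §8 (8.6)] -/
private theorem conj_vk2 {D k : ℕ} (hP2 : 1 < Skeleton.P2 D) (hk0 : 0 < k)
    (hk : (k : ℝ) < Skeleton.P2 D) :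
    conj (vk2 D k) =
      ((Real.log (Skeleton.P2 D / k) / Real.log (Skeleton.P2 D) : ℝ) : ℂ) *
        ((Skeleton.P2 D / k : ℝ) : ℂ) ^ (-betaMu D 7) := by
  have hk0' : (0 : ℝ) < k := by exact_mod_cast hk0
  have hP20 : 0 < Skeleton.P2 D := by linarith
  have hlog : Real.log (Skeleton.P2 D) ≠ 0 := (Real.log_pos hP2).ne'
  have harg : (((Skeleton.P2 D / k : ℝ)) : ℂ).arg ≠ π := by
    rw [Complex.arg_ofReal_of_nonneg (div_pos hP20 hk0').le]; exact Real.pi_ne_zero.symm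
  have hβ : -betaMu D 7 = conj (beta7 D) := by
    rw [show beta7 D = betaMu D 7 by simp [betaMu], conj_betaMu]
  rw [vk2, if_pos hk, map_mul, Complex.conj_ofReal, hβ, Complex.cpow_conj _ _ harg,
    Complex.conj_ofReal]
  congr 2
  rw [Real.log_div hP20.ne' hk0'.ne']
  field_simp

/-- The generic truncation-and-rescaling step: for `X ≤ P/T²` (`X > 1`) and `y = X/(dr)`,
`Σ_{n<⌈PT⁻²⌉} χ(n)·c(drn)·ξ₀ⱼ(n;d,r)/n = Σ_{n<⌈y⌉} χ(n)ξ₀ⱼ(n;d,r)n⁻¹(y/n)^{−β}log(y/n)/log X` when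
`c(k) = (log(X/k)/log X)(X/k)^{−β}` for `k < X` and `c(k) = 0` for `k ≥ X`. [cite: Zhang2022LandauSiegel, §8 (8.6)] -/
private theorem sum_rescale (c' : ℝ) {D : ℕ} (χ : DirichletCharacter ℂ D) (j d r : ℕ) (hd : 0 < d)
    (hr : 0 < r) {X : ℝ} (hX1 : 1 < X) (hXN : X ≤ bigP D / bigT D ^ 2) (β : ℂ) (c : ℕ → ℂ)
    (hc_lt : ∀ k : ℕ, 0 < k → (k : ℝ) < X →
      c k = ((Real.log (X / k) / Real.log X : ℝ) : ℂ) * ((X / k : ℝ) : ℂ) ^ (-β))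
    (hc_ge : ∀ k : ℕ, X ≤ (k : ℝ) → c k = 0) :
    ∑ n ∈ Finset.Ico 1 (Nsupp D), χ (n : ZMod D) * c (d * r * n) * xiZero c' D j n d r / (n : ℂ) =
      (1 / (Real.log X : ℂ)) * ∑ n ∈ Finset.Ico 1 ⌈X / ((d * r : ℕ) : ℝ)⌉₊,
        χ (n : ZMod D) * xiZero c' D j n d r / (n : ℂ) *
          ((X / ((d * r : ℕ) : ℝ) / n : ℝ) : ℂ) ^ (-β) * (Real.log (X / ((d * r : ℕ) : ℝ) / n) : ℂ) := by
  have hdr0 : (0 : ℝ) < ((d * r : ℕ) : ℝ) := by exact_mod_cast Nat.mul_pos hd hr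
  have hdr1 : (1 : ℝ) ≤ ((d * r : ℕ) : ℝ) := by exact_mod_cast Nat.mul_pos hd hr
  set y : ℝ := X / ((d * r : ℕ) : ℝ) with hy
  have hyX : y ≤ X := div_le_self (by linarith) hdr1
  -- the range `[1, ⌈y⌉)` sits inside `[1, Nsupp)`
  have hsub : Finset.Ico 1 ⌈y⌉₊ ⊆ Finset.Ico 1 (Nsupp D) := by
    refine Finset.Ico_subset_Ico_right ?_
    rw [Nsupp]
    exact Nat.ceil_mono (hyX.trans hXN)
  rw [Finset.mul_sum, ← Finset.sum_subset hsub]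
  · refine Finset.sum_congr rfl fun n hn => ?_
    rw [Finset.mem_Ico] at hn
    have hn0 : 0 < n := hn.1
    have hn0' : (0 : ℝ) < n := by exact_mod_cast hn0
    have hny : (n : ℝ) < y := Nat.lt_ceil.mp hn.2
    have hk : ((d * r * n : ℕ) : ℝ) < X := by
      rw [hy, lt_div_iff₀ hdr0] at hny
      push_cast at hny ⊢
      linarith [hny]
    have hkpos : 0 < d * r * n := Nat.mul_pos (Nat.mul_pos hd hr) hn0
    rw [hc_lt _ hkpos hk]
    have hXk : X / ((d * r * n : ℕ) : ℝ) = y / n := by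
      rw [hy]; push_cast; rw [div_div]
    rw [hXk]
    have hlogX : (Real.log X : ℂ) ≠ 0 := by
      exact_mod_cast (Real.log_pos hX1).ne'
    push_cast
    field_simp
  · intro n hn hn'
    rw [Finset.mem_Ico] at hn
    have hn0 : 0 < n := hn.1
    have hny : y ≤ (n : ℝ) := by
      by_contra h
      exact hn' (Finset.mem_Ico.mpr ⟨hn.1, Nat.lt_ceil.mpr (not_le.mp h)⟩)
    have hk : X ≤ ((d * r * n : ℕ) : ℝ) := by
      rw [hy, div_le_iff₀ hdr0] at hny
      push_cast at hny ⊢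
      linarith [hny]
    rw [hc_ge _ hk]
    simp


/-- `P₃ > 1`, `P₃ ≤ P/T²`, `P₂ > 1`, `P₂ ≤ P/T²` for `𝓛 ≥ 3`. [cite: Zhang2022LandauSiegel, §2 (2.21)] -/
private theorem P3_P2_facts {D : ℕ} (hℓ : 3 ≤ ell D) :
    1 < P3 D ∧ P3 D ≤ bigP D / bigT D ^ 2 ∧ 1 < Skeleton.P2 D ∧ Skeleton.P2 D ≤ bigP D / bigT D ^ 2 := by
  have h1 : 1 ≤ ell D := by linarith
  have h0 : 0 < ell D := by linarith
  have hP : 0 < bigP D := Real.exp_pos _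
  have hP1 : 1 < bigP D := by rw [bigP]; exact Real.one_lt_exp_iff.mpr (by positivity)
  have h504 := Sec10B.rpow504_le_nsuppBound hℓ
  have h11 := ell_rpow_le_sq h1
  have h7 : (3 : ℝ) ^ 7 ≤ ell D ^ 7 := pow_le_pow_left₀ (by norm_num) hℓ 7
  refine ⟨?_, ?_, ?_, ?_⟩
  · rw [P3]; exact Real.one_lt_rpow hP1 (by norm_num)
  · exact (Real.rpow_le_rpow_of_exponent_le hP1.le (by norm_num : (0.498 : ℝ) ≤ 0.504)).trans h504
  · have hP2pos : 0 < Skeleton.P2 D := by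
      rw [Skeleton.P2]; exact div_pos (Real.rpow_pos_of_pos hP _) (pow_pos (Real.exp_pos _) _)
    have hlog : 0 < Real.log (Skeleton.P2 D) := by
      rw [log_P2]; nlinarith [pow_nonneg h0.le 2]
    by_contra h
    have := Real.log_nonpos hP2pos.le (not_lt.mp h)
    linarith
  · calc Skeleton.P2 D ≤ bigP D ^ (0.5 : ℝ) := by
          rw [Skeleton.P2]
          exact div_le_self (Real.rpow_nonneg hP.le _)
            (one_le_pow₀ (Real.one_le_exp (Real.rpow_nonneg h0.le _)))
      _ ≤ bigP D ^ (0.504 : ℝ) := Real.rpow_le_rpow_of_exponent_le hP1.le (by norm_num)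
      _ ≤ _ := h504

/-- **The `n`-sum of `S_j(𝐚₁₄,𝐚₂₂)` is a combination of two sums of Lemma 8.4** (exact, `𝓛 ≥ 3`,
`d, r ≥ 1`): `Σ_n χ(n)(ι₃ conj ϰ₃(drn) + ι₄ conj ϰ₂(drn))ξ₀ⱼ(n;d,r)/n
 = (ι₃/log P₃)·Σ_{n<P₃/dr} χ(n)ξ₀ⱼ(n;d,r)n⁻¹(x₃/n)^{−β₆}log(x₃/n) + (ι₄/log P₂)·Σ_{n<P₂/dr} (…)(x₂/n)^{−β₇}log(x₂/n)`,
`x₃ = P₃/(dr)`, `x₂ = P₂/(dr)` — the two sums are those of `Skeleton.Lemma84` at `μ = 6, y = x₃` and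
`μ = 7, y = x₂` ("the results in Section 8"). [cite: Zhang2022LandauSiegel, §10 p. 59] -/
theorem nSum22_eq_lemma84_sums (c' : ℝ) {D : ℕ} (χ : DirichletCharacter ℂ D) (hℓ : 3 ≤ ell D)
    (j : ℕ) {d r : ℕ} (hd : 1 ≤ d) (hr : 1 ≤ r) :
    Sec10C.nSum22 c' χ j d r =
      iota3 * (1 / (Real.log (P3 D) : ℂ)) *
          (∑ n ∈ Finset.Ico 1 ⌈P3 D / ((d * r : ℕ) : ℝ)⌉₊,
            χ (n : ZMod D) * xiZero c' D j n d r / (n : ℂ) *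
              ((P3 D / ((d * r : ℕ) : ℝ) / n : ℝ) : ℂ) ^ (-betaMu D 6) *
                (Real.log (P3 D / ((d * r : ℕ) : ℝ) / n) : ℂ)) +
        iota4 * (1 / (Real.log (Skeleton.P2 D) : ℂ)) *
          (∑ n ∈ Finset.Ico 1 ⌈Skeleton.P2 D / ((d * r : ℕ) : ℝ)⌉₊,
            χ (n : ZMod D) * xiZero c' D j n d r / (n : ℂ) *
              ((Skeleton.P2 D / ((d * r : ℕ) : ℝ) / n : ℝ) : ℂ) ^ (-betaMu D 7) *
                (Real.log (Skeleton.P2 D / ((d * r : ℕ) : ℝ) / n) : ℂ)) := by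
  obtain ⟨hP3, hP3N, hP2, hP2N⟩ := P3_P2_facts hℓ
  have h3 := sum_rescale c' χ j d r hd hr hP3 hP3N (betaMu D 6) (fun k => conj (vk3 D k))
    (fun k hk0 hk => conj_vk3 hP3 hk0 hk)
    (fun k hk => by simp only [vk3, if_neg (not_lt.mpr hk), map_zero])
  have h2 := sum_rescale c' χ j d r hd hr hP2 hP2N (betaMu D 7) (fun k => conj (vk2 D k))
    (fun k hk0 hk => conj_vk2 hP2 hk0 hk)
    (fun k hk => by simp only [vk2, if_neg (not_lt.mpr hk), map_zero])
  rw [mul_assoc iota3, ← h3, mul_assoc iota4, ← h2, Sec10C.nSum22, Finset.mul_sum, Finset.mul_sum,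
    ← Finset.sum_add_distrib]
  refine Finset.sum_congr rfl fun n _ => ?_
  ring

/-- `‖ι₃‖ ≤ 5/4` (`ι₃ = −1.00635 − 0.22789i`). [cite: Zhang2022LandauSiegel, §2 (2.26)] -/
private theorem norm_iota3_le : ‖iota3‖ ≤ 5 / 4 := by
  rw [iota3]
  refine (norm_sub_le _ _).trans ?_
  rw [norm_mul, Complex.norm_I, mul_one, norm_neg]
  have h1 : ‖(1.00635 : ℂ)‖ = 1.00635 := by
    rw [show (1.00635 : ℂ) = ((1.00635 : ℝ) : ℂ) by norm_num, Complex.norm_real, Real.norm_of_nonneg]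
    norm_num
  have h2 : ‖(0.22789 : ℂ)‖ = 0.22789 := by
    rw [show (0.22789 : ℂ) = ((0.22789 : ℝ) : ℂ) by norm_num, Complex.norm_real, Real.norm_of_nonneg]
    norm_num
  rw [h1, h2]
  norm_num

/-- `‖ι₄‖ ≤ 23/10` (`ι₄ = −0.68738 + 1.60688i`). [cite: Zhang2022LandauSiegel, §2 (2.26)] -/
private theorem norm_iota4_le : ‖iota4‖ ≤ 23 / 10 := by
  rw [iota4]
  refine (norm_add_le _ _).trans ?_
  rw [norm_mul, Complex.norm_I, mul_one, norm_neg]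
  have h1 : ‖(0.68738 : ℂ)‖ = 0.68738 := by
    rw [show (0.68738 : ℂ) = ((0.68738 : ℝ) : ℂ) by norm_num, Complex.norm_real, Real.norm_of_nonneg]
    norm_num
  have h2 : ‖(1.60688 : ℂ)‖ = 1.60688 := by
    rw [show (1.60688 : ℂ) = ((1.60688 : ℝ) : ℂ) by norm_num, Complex.norm_real, Real.norm_of_nonneg]
    norm_num
  rw [h1, h2]
  norm_num

/-- From an approximation `‖Σ − L′·Π·𝔤‖ ≤ e` and the bounds `‖L′‖ ≤ A`, `‖Π‖ ≤ ρ`, `‖𝔤‖ ≤ G`: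
`‖Σ‖ ≤ AρG + e`. [folklore] -/
private theorem norm_le_of_approx {S L Pw g : ℂ} {e A ρ G : ℝ} (h : ‖S - L * Pw * g‖ ≤ e)
    (hL : ‖L‖ ≤ A) (hPw : ‖Pw‖ ≤ ρ) (hg : ‖g‖ ≤ G) (hA : 0 ≤ A) (hρ : 0 ≤ ρ) :
    ‖S‖ ≤ A * ρ * G + e := by
  have h1 : ‖S‖ ≤ ‖L * Pw * g‖ + ‖S - L * Pw * g‖ := norm_le_norm_add_norm_sub' S _
  have h2 : ‖L * Pw * g‖ ≤ A * ρ * G := by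
    rw [norm_mul, norm_mul]
    gcongr
  linarith

/-- `‖a·s + b·t‖ ≤ A·S + B·T` from the four norm bounds. [folklore] -/
private theorem norm_add_mul_le {a b s t : ℂ} {A B S T : ℝ} (ha : ‖a‖ ≤ A) (hb : ‖b‖ ≤ B)
    (hs : ‖s‖ ≤ S) (ht : ‖t‖ ≤ T) (hA : 0 ≤ A) (hB : 0 ≤ B) : ‖a * s + b * t‖ ≤ A * S + B * T := by
  refine (norm_add_le _ _).trans ?_
  refine add_le_add ((norm_mul_le _ _).trans ?_) ((norm_mul_le _ _).trans ?_)
  · exact mul_le_mul ha hs (norm_nonneg _) hA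
  · exact mul_le_mul hb ht (norm_nonneg _) hB

/-- **Size of the `n`-sum on `dr < P^{0.496}`** under the two Lemma 8.4 approximations with constant
`C₈₄ ≥ 0` (the hypotheses `h6`, `h7` are Lemma 8.4 at `μ = 6, y = P₃/(dr)` and `μ = 7, y = P₂/(dr)`):
`‖nSum22‖ ≤ (dr/φ(dr))²·K_N·𝓛⁻⁷`, `K_N = (5/4/0.498 + 23/10/0.4)(4e^{9/2}G₀ + C₈₄)`, `G₀` any bound for
`‖𝔤_{jμ}(y)‖` on `|log y| ≤ 𝓛⁹` (the tree's `Section9Discharge.norm_frakgW_le` provides one), using `‖L′(1,χ)‖ ≤ 4e^{9/2}𝓛²`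
(`Lemma31.norm_deriv_LFunction_le_near_one`), `‖Π(d,r)‖ ≤ (dr/φ(dr))²` (`Skeleton.norm_PiW_le`),
`log P₃ = 0.498𝓛⁹`, `log P₂ ≥ 0.4𝓛⁹`. [cite: Zhang2022LandauSiegel, §10 p. 59] -/
theorem norm_nSum22_le (c' : ℝ) {D : ℕ} [NeZero D] (χ : DirichletCharacter ℂ D) (hℓ4 : 4 ≤ ell D)
    (hp : χ.IsPrimitive) {C84 G0 : ℝ} (hC84 : 0 ≤ C84) (hG0 : 0 ≤ G0) (j : ℕ)
    (hG : ∀ μ : ℕ, ∀ y : ℝ, |Real.log y| ≤ ell D ^ 9 → ‖frakgW c' D j μ y‖ ≤ G0)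
    {d r : ℕ} (hd : 1 ≤ d) (hr : 1 ≤ r) (hdr : ((d * r : ℕ) : ℝ) < bigP D ^ (0.496 : ℝ))
    (h6 : ‖(∑ n ∈ Finset.Ico 1 ⌈P3 D / ((d * r : ℕ) : ℝ)⌉₊,
            χ (n : ZMod D) * xiZero c' D j n d r / (n : ℂ) *
              ((P3 D / ((d * r : ℕ) : ℝ) / n : ℝ) : ℂ) ^ (-betaMu D 6) *
                (Real.log (P3 D / ((d * r : ℕ) : ℝ) / n) : ℂ)) -
          deriv χ.LFunction 1 * PiW χ d r * frakgW c' D j 6 (P3 D / ((d * r : ℕ) : ℝ))‖ ≤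
        C84 * (ell D ^ 6)⁻¹)
    (h7 : ‖(∑ n ∈ Finset.Ico 1 ⌈Skeleton.P2 D / ((d * r : ℕ) : ℝ)⌉₊,
            χ (n : ZMod D) * xiZero c' D j n d r / (n : ℂ) *
              ((Skeleton.P2 D / ((d * r : ℕ) : ℝ) / n : ℝ) : ℂ) ^ (-betaMu D 7) *
                (Real.log (Skeleton.P2 D / ((d * r : ℕ) : ℝ) / n) : ℂ)) -
          deriv χ.LFunction 1 * PiW χ d r * frakgW c' D j 7 (Skeleton.P2 D / ((d * r : ℕ) : ℝ))‖ ≤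
        C84 * (ell D ^ 6)⁻¹) :
    ‖Sec10C.nSum22 c' χ j d r‖ ≤
      ((((d * r : ℕ) : ℝ)) / Nat.totient (d * r)) ^ 2 *
        ((5 / 4 / 0.498 + 23 / 10 / 0.4) * (4 * Real.exp (9 / 2) * G0 + C84)) / ell D ^ 7 := by
  have hℓ : 3 ≤ ell D := by linarith
  have h1 : 1 ≤ ell D := by linarith
  have h0 : 0 < ell D := by linarith
  obtain ⟨hP3, hP3N, hP2, hP2N⟩ := P3_P2_facts hℓ
  have hP : 0 < bigP D := Real.exp_pos _
  have hP1 : 1 < bigP D := by rw [bigP]; exact Real.one_lt_exp_iff.mpr (by positivity)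
  have hdr0 : (0 : ℝ) < ((d * r : ℕ) : ℝ) := by exact_mod_cast Nat.mul_pos hd hr
  have hdr1 : (1 : ℝ) ≤ ((d * r : ℕ) : ℝ) := by exact_mod_cast Nat.mul_pos hd hr
  obtain ⟨ρ, hρ⟩ : ∃ ρ : ℝ, ρ = (((d * r : ℕ) : ℝ)) / Nat.totient (d * r) := ⟨_, rfl⟩
  rw [← hρ]
  have hρ1 : 1 ≤ ρ := by rw [hρ]; exact one_le_self_div_totient (Nat.mul_pos hd hr).ne'
  have hρ0 : 0 ≤ ρ := by linarith
  -- ‖L′(1,χ)‖ ≤ 4e^{9/2}𝓛²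
  have hLp : ‖deriv χ.LFunction 1‖ ≤ 4 * Real.exp (9 / 2) * ell D ^ 2 := by
    have hq : 3 ≤ Real.log (D : ℕ) := by simpa [ell] using hℓ
    have h := Lemma31.norm_deriv_LFunction_le_near_one (χ := χ) hq hp (w := 1)
      (by rw [sub_self, norm_zero]; exact div_nonneg zero_le_one (by linarith))
    rw [← ell] at h
    calc ‖deriv χ.LFunction 1‖ ≤ 2 * Real.exp (9 / 2) * (1 + ell D) * ell D := h
      _ ≤ 2 * Real.exp (9 / 2) * (2 * ell D) * ell D := by gcongr; linarith
      _ = 4 * Real.exp (9 / 2) * ell D ^ 2 := by ring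
  -- ‖Π(d,r)‖ ≤ ρ²
  have hPiW : ‖PiW χ d r‖ ≤ ρ ^ 2 := by rw [hρ]; exact norm_PiW_le χ (by omega) (by omega)
  -- the two arguments lie in `[1, P]`
  have hx3lo : 1 ≤ P3 D / ((d * r : ℕ) : ℝ) := by
    rw [le_div_iff₀ hdr0, one_mul]
    refine hdr.le.trans ?_
    rw [P3]; exact Real.rpow_le_rpow_of_exponent_le hP1.le (by norm_num)
  have hx3hi : P3 D / ((d * r : ℕ) : ℝ) ≤ bigP D := by
    refine (div_le_self (by linarith) hdr1).trans ?_
    rw [P3]; exact Real.rpow_le_self_of_one_le hP1.le (by norm_num)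
  have hx2lo : 1 ≤ Skeleton.P2 D / ((d * r : ℕ) : ℝ) := by
    rw [le_div_iff₀ hdr0, one_mul]
    refine hdr.le.trans ?_
    -- `P^{0.496} ≤ P₂ = P^{0.5}/T^{10}` iff `10𝓛^{1.1} ≤ 0.004𝓛⁹`
    have hT0 : 0 < bigT D := Real.exp_pos _
    rw [Skeleton.P2, le_div_iff₀ (pow_pos hT0 10)]
    have hT : bigT D ^ 10 = Real.exp (10 * ell D ^ (1.1 : ℝ)) := by
      rw [bigT, ← Real.exp_nat_mul]; norm_num
    rw [hT, bigP, ← Real.exp_mul, ← Real.exp_mul, ← Real.exp_add, Real.exp_le_exp]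
    have h11 := ell_rpow_le_sq h1
    have h7 : (4 : ℝ) ^ 7 ≤ ell D ^ 7 := pow_le_pow_left₀ (by norm_num) hℓ4 7
    nlinarith [pow_nonneg h0.le 2]
  have hx2hi : Skeleton.P2 D / ((d * r : ℕ) : ℝ) ≤ bigP D := by
    refine (div_le_self (by linarith) hdr1).trans ?_
    calc Skeleton.P2 D ≤ bigP D ^ (0.5 : ℝ) := by
          rw [Skeleton.P2]
          exact div_le_self (Real.rpow_nonneg hP.le _)
            (one_le_pow₀ (Real.one_le_exp (Real.rpow_nonneg h0.le _)))
      _ ≤ bigP D := Real.rpow_le_self_of_one_le hP1.le (by norm_num)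
  have hlogx : ∀ x : ℝ, 1 ≤ x → x ≤ bigP D → |Real.log x| ≤ ell D ^ 9 := by
    intro x hx1 hx2
    rw [abs_of_nonneg (Real.log_nonneg hx1), ← log_bigP]
    exact Real.log_le_log (by linarith) hx2
  have hg6 : ‖frakgW c' D j 6 (P3 D / ((d * r : ℕ) : ℝ))‖ ≤ G0 := hG 6 _ (hlogx _ hx3lo hx3hi)
  have hg7 : ‖frakgW c' D j 7 (Skeleton.P2 D / ((d * r : ℕ) : ℝ))‖ ≤ G0 := hG 7 _ (hlogx _ hx2lo hx2hi)
  -- the two Lemma 8.4 sums are bounded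
  have hS6 := norm_le_of_approx h6 hLp hPiW hg6 (by positivity) (by positivity)
  have hS7 := norm_le_of_approx h7 hLp hPiW hg7 (by positivity) (by positivity)
  -- logs of `P₃`, `P₂`
  have hlog3 : Real.log (P3 D) = 0.498 * ell D ^ 9 := log_P3 D
  have hlog2 : 0.4 * ell D ^ 9 ≤ Real.log (Skeleton.P2 D) := by
    rw [log_P2]
    have h11 := ell_rpow_le_sq h1
    have h7 : (3 : ℝ) ^ 7 ≤ ell D ^ 7 := pow_le_pow_left₀ (by norm_num) hℓ 7
    nlinarith [pow_nonneg h0.le 2]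
  have hl9 : 0 < ell D ^ 9 := by positivity
  have hlog3pos : 0 < Real.log (P3 D) := by rw [hlog3]; positivity
  have hlog2pos : 0 < Real.log (Skeleton.P2 D) := by linarith [hlog2]
  have hn3 : ‖iota3 * (1 / (Real.log (P3 D) : ℂ))‖ ≤ 5 / 4 / (0.498 * ell D ^ 9) := by
    rw [norm_mul, norm_div, norm_one, Complex.norm_real, Real.norm_of_nonneg hlog3pos.le, hlog3,
      ← div_eq_mul_one_div]
    exact div_le_div_of_nonneg_right norm_iota3_le (by positivity)
  have hn4 : ‖iota4 * (1 / (Real.log (Skeleton.P2 D) : ℂ))‖ ≤ 23 / 10 / (0.4 * ell D ^ 9) := by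
    rw [norm_mul, norm_div, norm_one, Complex.norm_real, Real.norm_of_nonneg hlog2pos.le,
      ← div_eq_mul_one_div]
    exact div_le_div₀ (by norm_num) norm_iota4_le (by positivity) hlog2
  -- common majorant of the two Lemma 8.4 sums
  set B : ℝ := ρ ^ 2 * ell D ^ 2 * (4 * Real.exp (9 / 2) * G0 + C84) with hB
  clear h6 h7
  have hC84' : C84 * (ell D ^ 6)⁻¹ ≤ ρ ^ 2 * ell D ^ 2 * C84 := by
    have hl6 : (1 : ℝ) ≤ ell D ^ 6 := one_le_pow₀ h1
    have hinv : (ell D ^ 6)⁻¹ ≤ 1 := inv_le_one_of_one_le₀ hl6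
    have hρ2a : (1 : ℝ) ≤ ρ ^ 2 := one_le_pow₀ hρ1
    have hℓ2 : (1 : ℝ) ≤ ell D ^ 2 := one_le_pow₀ h1
    have hρ2 : (1 : ℝ) ≤ ρ ^ 2 * ell D ^ 2 := one_le_mul_of_one_le_of_one_le hρ2a hℓ2
    calc C84 * (ell D ^ 6)⁻¹ ≤ C84 * 1 := by gcongr
      _ ≤ ρ ^ 2 * ell D ^ 2 * C84 := by rw [mul_one]; exact le_mul_of_one_le_left hC84 hρ2
  have hSB : ∀ S : ℂ, ‖S‖ ≤ 4 * Real.exp (9 / 2) * ell D ^ 2 * ρ ^ 2 * G0 + C84 * (ell D ^ 6)⁻¹ →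
      ‖S‖ ≤ B := by
    intro S hS
    rw [hB]
    calc ‖S‖ ≤ 4 * Real.exp (9 / 2) * ell D ^ 2 * ρ ^ 2 * G0 + C84 * (ell D ^ 6)⁻¹ := hS
      _ ≤ 4 * Real.exp (9 / 2) * ell D ^ 2 * ρ ^ 2 * G0 + ρ ^ 2 * ell D ^ 2 * C84 := by gcongr
      _ = ρ ^ 2 * ell D ^ 2 * (4 * Real.exp (9 / 2) * G0 + C84) := by ring
  have hB6 := hSB _ hS6
  have hB7 := hSB _ hS7
  have hBpos : 0 ≤ B := by positivity
  rw [nSum22_eq_lemma84_sums c' χ hℓ j hd hr]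
  refine (norm_add_mul_le hn3 hn4 hB6 hB7 (by positivity) (by positivity)).trans (le_of_eq ?_)
  rw [hB]
  have h9 : ell D ^ 9 = ell D ^ 7 * ell D ^ 2 := by ring
  rw [h9]
  field_simp


/-! ### The `(d,r)`-weights and the per-term bound -/

/-- `‖ |χ(d)|·|μχ(r)| ‖ ≤ [r squarefree]` (as complex-cast reals). [cite: Zhang2022LandauSiegel, §10 p. 59] -/
private theorem norm_chi_moebius_le {D : ℕ} (χ : DirichletCharacter ℂ D) (d r : ℕ) :
    ‖((‖χ (d : ZMod D)‖ : ℂ)) * ((‖(ArithmeticFunction.moebius r : ℂ) * χ (r : ZMod D)‖ : ℂ))‖ ≤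
      if Squarefree r then 1 else 0 := by
  rw [norm_mul, Complex.norm_real, Complex.norm_real, Real.norm_of_nonneg (norm_nonneg _),
    Real.norm_of_nonneg (norm_nonneg _), norm_mul]
  split_ifs with hsq
  · have h1 : ‖χ (d : ZMod D)‖ ≤ 1 := χ.norm_le_one _
    have h2 : ‖χ (r : ZMod D)‖ ≤ 1 := χ.norm_le_one _
    have h3 : ‖(ArithmeticFunction.moebius r : ℂ)‖ ≤ 1 := by
      rw [Complex.norm_intCast]
      have := ArithmeticFunction.abs_moebius_le_one (n := r)
      exact_mod_cast this
    calc ‖χ (d : ZMod D)‖ * (‖(ArithmeticFunction.moebius r : ℂ)‖ * ‖χ (r : ZMod D)‖)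
        ≤ 1 * (1 * 1) := by gcongr
      _ = 1 := by ring
  · rw [ArithmeticFunction.moebius_eq_zero_of_not_squarefree hsq]
    simp

/-- **Per-term bound.** For `n = dr ≥ 1`, `r ∣ n`: `‖term1422(d,r)‖ ≤ [r sqfree]φ(r)⁻¹·(n/φ(n))⁴n⁻¹·M·N`
whenever `‖m-sum‖ ≤ M` and `‖n-sum‖ ≤ N` (`‖λ₀ⱼ(n)‖ ≤ (n/φ(n))⁴`, `Skeleton.norm_lamZero_le`).
[cite: Zhang2022LandauSiegel, §10 p. 59] -/
private theorem norm_term1422_le (c' : ℝ) {D : ℕ} [NeZero D] (χ : DirichletCharacter ℂ D) (j : ℕ)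
    {n r : ℕ} (hn : n ≠ 0) (hrn : r ∣ n) {Mv Nv : ℝ}
    (hM : ‖Sec10C.mSum14 c' χ j (n / r) r‖ ≤ Mv) (hN : ‖Sec10C.nSum22 c' χ j (n / r) r‖ ≤ Nv)
    (hMv : 0 ≤ Mv) :
    ‖term1422 c' χ j (n / r) r‖ ≤
      (if Squarefree r then 1 / (Nat.totient r : ℝ) else 0) *
        ((((n : ℝ) / Nat.totient n) ^ 4) / n) * Mv * Nv := by
  have hr0 : r ≠ 0 := by rintro rfl; simp at hrn; exact hn hrn
  have hdr : n / r * r = n := Nat.div_mul_cancel hrn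
  have hn0 : (0 : ℝ) < n := by exact_mod_cast Nat.pos_of_ne_zero hn
  have hφr : (0 : ℝ) < Nat.totient r := by exact_mod_cast Nat.totient_pos.mpr (Nat.pos_of_ne_zero hr0)
  have hNv : 0 ≤ Nv := (norm_nonneg _).trans hN
  unfold term1422
  rw [hdr]
  rw [norm_mul, norm_mul, norm_div, norm_mul ((n : ℕ) : ℂ) ((Nat.totient r : ℕ) : ℂ),
    Complex.norm_natCast, Complex.norm_natCast, norm_mul _ (lamZero c' D j n)]
  have hw := norm_chi_moebius_le χ (n / r) r
  have hlam := norm_lamZero_le c' D j hn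
  split_ifs at hw ⊢ with hsq
  · calc ‖((‖χ ((n / r : ℕ) : ZMod D)‖ : ℂ)) * ((‖(ArithmeticFunction.moebius r : ℂ) * χ (r : ZMod D)‖ : ℂ))‖ *
          ‖lamZero c' D j n‖ / ((n : ℝ) * Nat.totient r) * ‖Sec10C.mSum14 c' χ j (n / r) r‖ *
          ‖Sec10C.nSum22 c' χ j (n / r) r‖
        ≤ 1 * ((n : ℝ) / Nat.totient n) ^ 4 / ((n : ℝ) * Nat.totient r) * Mv * Nv := by
          gcongr
      _ = 1 / (Nat.totient r : ℝ) * ((((n : ℝ) / Nat.totient n) ^ 4) / n) * Mv * Nv := by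
          field_simp
  · have h0 : ‖((‖χ ((n / r : ℕ) : ZMod D)‖ : ℂ)) *
        ((‖(ArithmeticFunction.moebius r : ℂ) * χ (r : ZMod D)‖ : ℂ))‖ = 0 :=
      le_antisymm hw (norm_nonneg _)
    rw [h0]
    simp


/-- **Per-`n` bound**: summing the per-term bound over the divisors `r ∣ n` with
`Σ_{r∣n, r sqfree} φ(r)⁻¹ = n/φ(n)` (`Skeleton.sum_sqfree_divisors_inv_totient`) gives
`Σ_{r∣n} ‖term1422(n/r,r)‖ ≤ (n/φ(n))⁷n⁻¹·M·K` when `‖m-sum‖ ≤ M` and `‖n-sum‖ ≤ (n/φ(n))²K`.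
[cite: Zhang2022LandauSiegel, §10 p. 59] -/
private theorem sum_divisors_term1422_le (c' : ℝ) {D : ℕ} [NeZero D] (χ : DirichletCharacter ℂ D)
    (j : ℕ) {n : ℕ} (hn : n ≠ 0) {Mv K : ℝ} (hMv : 0 ≤ Mv)
    (hM : ∀ r ∈ n.divisors, ‖Sec10C.mSum14 c' χ j (n / r) r‖ ≤ Mv)
    (hN : ∀ r ∈ n.divisors, ‖Sec10C.nSum22 c' χ j (n / r) r‖ ≤ ((n : ℝ) / Nat.totient n) ^ 2 * K) :
    ∑ r ∈ n.divisors, ‖term1422 c' χ j (n / r) r‖ ≤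
      ((n : ℝ) / Nat.totient n) ^ 7 / n * Mv * K := by
  have hn0 : (0 : ℝ) < n := by exact_mod_cast Nat.pos_of_ne_zero hn
  have hρ : 0 ≤ (n : ℝ) / Nat.totient n := by positivity
  calc ∑ r ∈ n.divisors, ‖term1422 c' χ j (n / r) r‖
      ≤ ∑ r ∈ n.divisors, (if Squarefree r then 1 / (Nat.totient r : ℝ) else 0) *
          ((((n : ℝ) / Nat.totient n) ^ 4) / n) * Mv * (((n : ℝ) / Nat.totient n) ^ 2 * K) :=
        Finset.sum_le_sum fun r hr =>
          norm_term1422_le c' χ j hn (Nat.dvd_of_mem_divisors hr) (hM r hr) (hN r hr) hMv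
    _ = (∑ r ∈ n.divisors with Squarefree r, (1 / (Nat.totient r : ℝ))) *
          (((((n : ℝ) / Nat.totient n) ^ 4) / n) * Mv * (((n : ℝ) / Nat.totient n) ^ 2 * K)) := by
        rw [Finset.sum_filter, Finset.sum_mul]
        refine Finset.sum_congr rfl fun r _ => ?_
        split_ifs <;> ring
    _ = ((n : ℝ) / Nat.totient n) ^ 7 / n * Mv * K := by
        rw [sum_sqfree_divisors_inv_totient hn]
        ring

/-- `Σ_{1 ≤ n ≤ X} (n/φ(n))⁷/n ≤ 1 + e²⁵⁶(1 + log X)` (`X ≥ 1`; the `n = 1` term plus d41's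
`Skeleton.sum_ratio_pow_div_le 7` on `(1, X]`). [cite: Zhang2022LandauSiegel, §10 p. 59] -/
private theorem sum_Icc_ratio7_le {X : ℕ} (hX : 1 ≤ X) :
    ∑ n ∈ Finset.Icc 1 X, ((n : ℝ) / Nat.totient n) ^ 7 / n ≤
      1 + Real.exp 256 * (1 + Real.log X) := by
  rw [Finset.Icc_eq_cons_Ioc hX, Finset.sum_cons]
  have h1 : (((1 : ℕ) : ℝ) / Nat.totient 1) ^ 7 / ((1 : ℕ) : ℝ) = 1 := by simp
  rw [h1]
  have h := sum_ratio_pow_div_le 7 (Y := 1) (X := X) one_pos hX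
  simp only [Nat.cast_one, Real.log_one, sub_zero] at h
  have h256 : (2 : ℝ) ^ (7 + 1) = 256 := by norm_num
  rw [h256] at h
  linarith

/-- `Σ_{Y < n ≤ X} (n/φ(n))⁷/n ≤ e²⁵⁶(1 + log X − log Y)` (`1 ≤ Y ≤ X`; d41's lemma with `k = 7`).
[cite: Zhang2022LandauSiegel, §10 p. 59] -/
private theorem sum_Ioc_ratio7_le {Y X : ℕ} (hY : 0 < Y) (hYX : Y ≤ X) :
    ∑ n ∈ Finset.Ioc Y X, ((n : ℝ) / Nat.totient n) ^ 7 / n ≤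
      Real.exp 256 * (1 + Real.log X - Real.log Y) := by
  have h := sum_ratio_pow_div_le 7 hY hYX
  have h256 : (2 : ℝ) ^ (7 + 1) = 256 := by norm_num
  rwa [h256] at h

/-- `e^{−cL}·L¹¹ ≤ 12!/(c¹²L)` (`c, L > 0`), from `(cL)¹²/12! ≤ e^{cL}`. [folklore] -/
private theorem exp_neg_mul_pow_eleven_le {c L : ℝ} (hc : 0 < c) (hL : 0 < L) :
    Real.exp (-(c * L)) * L ^ 11 ≤ (Nat.factorial 12 : ℝ) / (c ^ 12 * L) := by
  have hx : 0 ≤ c * L := by positivity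
  have h := Real.pow_div_factorial_le_exp (c * L) hx 12
  have hfac : (0 : ℝ) < Nat.factorial 12 := by positivity
  have hcl : 0 < (c * L) ^ 12 := by positivity
  rw [Real.exp_neg]
  have hexp : 0 < Real.exp (c * L) := Real.exp_pos _
  have hinv : (Real.exp (c * L))⁻¹ ≤ (Nat.factorial 12 : ℝ) / (c * L) ^ 12 := by
    rw [inv_le_comm₀ hexp (by positivity), inv_div]
    exact h
  calc (Real.exp (c * L))⁻¹ * L ^ 11 ≤ (Nat.factorial 12 : ℝ) / (c * L) ^ 12 * L ^ 11 := by gcongr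
    _ = (Nat.factorial 12 : ℝ) / (c ^ 12 * L) := by
        field_simp

/-- The closing numerical step: for `L ≥ 1` with `K·e²⁵⁶(3·12!/c¹² + 4)/(επ) ≤ L`,
`K(3e²⁵⁶L¹¹e^{−cL} + e²⁵⁶(3 + L²)L⁻⁵) ≤ επ`. [folklore] -/
private theorem closing_bound {K c ε L : ℝ} (hK : 0 ≤ K) (hc : 0 < c) (hε : 0 < ε) (hL1 : 1 ≤ L)
    (hL : K * Real.exp 256 * (3 * (Nat.factorial 12 : ℝ) / c ^ 12 + 4) / (ε * π) ≤ L) :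
    K * (3 * Real.exp 256 * L ^ 11 * Real.exp (-(c * L)) + Real.exp 256 * (3 + L ^ 2) / L ^ 5) ≤
      ε * π := by
  have hL0 : 0 < L := by linarith
  have hπ := Real.pi_pos
  have hεπ : 0 < ε * π := by positivity
  have h1 : L ^ 11 * Real.exp (-(c * L)) ≤ (Nat.factorial 12 : ℝ) / (c ^ 12 * L) := by
    rw [mul_comm]; exact exp_neg_mul_pow_eleven_le hc hL0
  have h2 : (3 + L ^ 2) / L ^ 5 ≤ 4 / L := by
    rw [div_le_div_iff₀ (by positivity) hL0]
    have hL2 : 1 ≤ L ^ 2 := one_le_pow₀ hL1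
    have hL4 : L ^ 2 ≤ L ^ 4 := pow_le_pow_right₀ hL1 (by norm_num)
    nlinarith
  have hmain : K * (3 * Real.exp 256 * L ^ 11 * Real.exp (-(c * L)) +
      Real.exp 256 * (3 + L ^ 2) / L ^ 5) ≤
      K * Real.exp 256 * (3 * (Nat.factorial 12 : ℝ) / c ^ 12 + 4) / L := by
    have e256 : 0 < Real.exp 256 := Real.exp_pos _
    calc K * (3 * Real.exp 256 * L ^ 11 * Real.exp (-(c * L)) + Real.exp 256 * (3 + L ^ 2) / L ^ 5)
        = K * (3 * Real.exp 256 * (L ^ 11 * Real.exp (-(c * L))) +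
            Real.exp 256 * ((3 + L ^ 2) / L ^ 5)) := by ring
      _ ≤ K * (3 * Real.exp 256 * ((Nat.factorial 12 : ℝ) / (c ^ 12 * L)) +
            Real.exp 256 * (4 / L)) := by gcongr
      _ = K * Real.exp 256 * (3 * (Nat.factorial 12 : ℝ) / c ^ 12 + 4) / L := by
          field_simp
  refine hmain.trans ?_
  rw [div_le_iff₀ hL0]
  rw [div_le_iff₀ hεπ] at hL
  linarith


/-- Main range: `Σ_{n ∈ F, n ≤ W} (n/φ(n))⁷/n ≤ 1 + e²⁵⁶(1 + log W)` for `W ≥ 1` and any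
`F ⊆ [1, ∞)`. [cite: Zhang2022LandauSiegel, §10 p. 59] -/
private theorem sum_main_le (F : Finset ℕ) (hF : ∀ n ∈ F, 1 ≤ n) {W : ℝ} (hW : 1 ≤ W) :
    ∑ n ∈ F.filter (fun n : ℕ => (n : ℝ) ≤ W), ((n : ℝ) / Nat.totient n) ^ 7 / n ≤
      1 + Real.exp 256 * (1 + Real.log W) := by
  have hW1 : 1 ≤ ⌊W⌋₊ := Nat.le_floor (by exact_mod_cast hW)
  have hsub : F.filter (fun n : ℕ => (n : ℝ) ≤ W) ⊆ Finset.Icc 1 ⌊W⌋₊ := by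
    intro n hn
    rw [Finset.mem_filter] at hn
    rw [Finset.mem_Icc]
    exact ⟨hF n hn.1, Nat.le_floor hn.2⟩
  calc ∑ n ∈ F.filter (fun n : ℕ => (n : ℝ) ≤ W), ((n : ℝ) / Nat.totient n) ^ 7 / n
      ≤ ∑ n ∈ Finset.Icc 1 ⌊W⌋₊, ((n : ℝ) / Nat.totient n) ^ 7 / n :=
        Finset.sum_le_sum_of_subset_of_nonneg hsub fun n _ _ => by positivity
    _ ≤ 1 + Real.exp 256 * (1 + Real.log (⌊W⌋₊ : ℕ)) := sum_Icc_ratio7_le hW1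
    _ ≤ 1 + Real.exp 256 * (1 + Real.log W) := by
        gcongr
        exact Nat.floor_le (by linarith)

/-- Window: `Σ_{n ∈ F, n > W} (n/φ(n))⁷/n ≤ e²⁵⁶(1 + 2 log 2 + max 0 (log X − log W))` for `W ≥ 1`,
`X ≥ 1` and any `F ⊆ [1, X)`. [cite: Zhang2022LandauSiegel, §10 p. 59] -/
private theorem sum_window_le (F : Finset ℕ) {X : ℝ} (hX : 1 ≤ X)
    (hF : ∀ n ∈ F, 1 ≤ n ∧ (n : ℝ) < X) {W : ℝ} (hW : 1 ≤ W) :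
    ∑ n ∈ F.filter (fun n : ℕ => ¬ (n : ℝ) ≤ W), ((n : ℝ) / Nat.totient n) ^ 7 / n ≤
      Real.exp 256 * (1 + 2 * Real.log 2 + max 0 (Real.log X - Real.log W)) := by
  have hlog2 : 0 < Real.log 2 := Real.log_pos (by norm_num)
  by_cases hWX : W ≤ X
  · have hY : 0 < ⌊W⌋₊ := Nat.floor_pos.mpr hW
    have hYX : ⌊W⌋₊ ≤ ⌈X⌉₊ := (Nat.floor_le_floor hWX).trans (Nat.floor_le_ceil X)
    have hsub : F.filter (fun n : ℕ => ¬ (n : ℝ) ≤ W) ⊆ Finset.Ioc ⌊W⌋₊ ⌈X⌉₊ := by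
      intro n hn
      rw [Finset.mem_filter] at hn
      rw [Finset.mem_Ioc]
      constructor
      · have h1 : (⌊W⌋₊ : ℝ) ≤ W := Nat.floor_le (by linarith)
        have h2 : W < n := not_le.mp hn.2
        exact_mod_cast h1.trans_lt h2
      · have := (hF n hn.1).2
        exact Nat.cast_le.mp ((this.le.trans (Nat.le_ceil X)).trans_eq (by norm_cast))
    calc ∑ n ∈ F.filter (fun n : ℕ => ¬ (n : ℝ) ≤ W), ((n : ℝ) / Nat.totient n) ^ 7 / n
        ≤ ∑ n ∈ Finset.Ioc ⌊W⌋₊ ⌈X⌉₊, ((n : ℝ) / Nat.totient n) ^ 7 / n :=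
          Finset.sum_le_sum_of_subset_of_nonneg hsub fun n _ _ => by positivity
      _ ≤ Real.exp 256 * (1 + Real.log (⌈X⌉₊ : ℕ) - Real.log (⌊W⌋₊ : ℕ)) := sum_Ioc_ratio7_le hY hYX
      _ ≤ Real.exp 256 * (1 + 2 * Real.log 2 + max 0 (Real.log X - Real.log W)) := by
          gcongr
          -- `log⌈X⌉ ≤ log X + log 2`, `log⌊W⌋ ≥ log W − log 2`
          have hc : (⌈X⌉₊ : ℝ) ≤ 2 * X := by
            have := Nat.ceil_lt_add_one (by linarith : (0 : ℝ) ≤ X)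
            linarith
          have hf : W / 2 ≤ (⌊W⌋₊ : ℝ) := by
            rcases le_or_gt 2 W with h2 | h2
            · have := Nat.lt_floor_add_one W
              linarith
            · have : (1 : ℝ) ≤ ⌊W⌋₊ := by exact_mod_cast hY
              linarith
          have h1 : Real.log (⌈X⌉₊ : ℕ) ≤ Real.log 2 + Real.log X := by
            rw [← Real.log_mul (by norm_num) (by linarith)]
            exact Real.log_le_log (by exact_mod_cast (lt_of_lt_of_le hY hYX)) hc
          have h2 : Real.log W - Real.log 2 ≤ Real.log (⌊W⌋₊ : ℕ) := by
            rw [← Real.log_div (by linarith) (by norm_num)]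
            exact Real.log_le_log (by linarith) hf
          have h3 : Real.log X - Real.log W ≤ max 0 (Real.log X - Real.log W) := le_max_right _ _
          linarith
  · have hempty : F.filter (fun n : ℕ => ¬ (n : ℝ) ≤ W) = ∅ := by
      rw [Finset.filter_eq_empty_iff]
      intro n hn h
      exact h (((hF n hn).2.le.trans (not_le.mp hWX).le))
    rw [hempty, Finset.sum_empty]
    have : 0 ≤ max 0 (Real.log X - Real.log W) := le_max_left _ _
    positivity

/-- The reindexed range sum: `S1422On(0, P^{0.496}) = Σ_{n<P^{0.496}} Σ_{r∣n} term1422(n/r, r)` (`n = dr`;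
d41's `Skeleton.sum_box_ite_eq_sum_divisors`). [cite: Zhang2022LandauSiegel, §10 p. 59] -/
private theorem S1422On_low_eq (c' : ℝ) {D : ℕ} [NeZero D] (χ : DirichletCharacter ℂ D)
    (hℓ : 3 ≤ ell D) (j : ℕ) :
    S1422On c' χ j 0 (bigP D ^ (0.496 : ℝ)) =
      ∑ n ∈ (Finset.Ico 1 (Nsupp D)).filter
          (fun n : ℕ => (0 : ℝ) ≤ (n : ℝ) ∧ (n : ℝ) < bigP D ^ (0.496 : ℝ)),
        ∑ r ∈ n.divisors, term1422 c' χ j (n / r) r := by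
  have hP1 : 1 < bigP D := by
    rw [bigP]; exact Real.one_lt_exp_iff.mpr (by positivity)
  have hp : ∀ n : ℕ, (0 : ℝ) ≤ (n : ℝ) ∧ (n : ℝ) < bigP D ^ (0.496 : ℝ) → n < Nsupp D := by
    intro n hn
    have h1 : (n : ℝ) < bigP D / bigT D ^ 2 :=
      hn.2.trans_le ((Real.rpow_le_rpow_of_exponent_le hP1.le (by norm_num)).trans
        (Sec10B.rpow504_le_nsuppBound hℓ))
    rw [Nsupp]
    exact_mod_cast h1.trans_le (Nat.le_ceil _)
  unfold S1422On
  rw [Finset.sum_comm]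
  exact sum_box_ite_eq_sum_divisors (Nsupp D)
    (fun n : ℕ => (0 : ℝ) ≤ (n : ℝ) ∧ (n : ℝ) < bigP D ^ (0.496 : ℝ)) hp
    (fun d r => term1422 c' χ j d r)


/-! ### Sizes used by the edge theorem (small-context lemmas) -/

/-- `Dt₀ ≤ P^{0.004}` for `𝓛 ≥ 5`. [cite: Zhang2022LandauSiegel, §2 (2.6), (2.8)] -/
private theorem D_mul_t0_le_rpow {D : ℕ} (hℓ5 : 5 ≤ ell D) :
    (D : ℝ) * t0 D ≤ bigP D ^ (0.004 : ℝ) := by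
  have h1 : 1 ≤ ell D := by linarith
  refine (D_mul_t0_le h1).trans ?_
  rw [show bigP D ^ (0.004 : ℝ) = Real.exp (0.004 * ell D ^ 9) by
    rw [bigP, ← Real.exp_mul]; ring_nf, Real.exp_le_exp]
  have h8 : (5 : ℝ) ^ 8 ≤ ell D ^ 8 := pow_le_pow_left₀ (by norm_num) hℓ5 8
  nlinarith

/-- `T ≤ P^{0.496}` for `𝓛 ≥ 3`. [cite: Zhang2022LandauSiegel, §2 (2.6)] -/
private theorem bigT_le_rpow496 {D : ℕ} (hℓ3 : 3 ≤ ell D) : bigT D ≤ bigP D ^ (0.496 : ℝ) := by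
  have h1 : 1 ≤ ell D := by linarith
  have h0 : 0 ≤ ell D := by linarith
  rw [bigT, show bigP D ^ (0.496 : ℝ) = Real.exp (0.496 * ell D ^ 9) by
    rw [bigP, ← Real.exp_mul]; ring_nf, Real.exp_le_exp]
  have h11 := ell_rpow_le_sq h1
  have h7 : (3 : ℝ) ^ 7 ≤ ell D ^ 7 := pow_le_pow_left₀ (by norm_num) hℓ3 7
  nlinarith [pow_nonneg h0 2]

/-- For `1 ≤ n < P^{0.496}` (`𝓛 ≥ 3`): `T < P₃/n < P`. [cite: Zhang2022LandauSiegel, §2 (2.21)] -/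
private theorem P3_div_window {D n : ℕ} (hℓ3 : 3 ≤ ell D) (hn : 1 ≤ n)
    (hnP : (n : ℝ) < bigP D ^ (0.496 : ℝ)) :
    bigT D < P3 D / n ∧ P3 D / n < bigP D := by
  have h1 : 1 ≤ ell D := by linarith
  have h0 : 0 ≤ ell D := by linarith
  have hP1 : 1 < bigP D := by
    rw [bigP]; exact Real.one_lt_exp_iff.mpr (pow_pos (by linarith) 9)
  have hn0 : (0 : ℝ) < n := by exact_mod_cast hn
  have hn1 : (1 : ℝ) ≤ n := by exact_mod_cast hn
  have hT0 : 0 < bigT D := Real.exp_pos _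
  constructor
  · rw [lt_div_iff₀ hn0]
    calc bigT D * n < bigT D * bigP D ^ (0.496 : ℝ) := by gcongr
      _ ≤ P3 D := by
          rw [P3, bigT, show bigP D ^ (0.496 : ℝ) = Real.exp (0.496 * ell D ^ 9) by
              rw [bigP, ← Real.exp_mul]; ring_nf,
            show bigP D ^ (0.498 : ℝ) = Real.exp (0.498 * ell D ^ 9) by
              rw [bigP, ← Real.exp_mul]; ring_nf, ← Real.exp_add, Real.exp_le_exp]
          have h11 := ell_rpow_le_sq h1
          have h7 : (3 : ℝ) ^ 7 ≤ ell D ^ 7 := pow_le_pow_left₀ (by norm_num) hℓ3 7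
          nlinarith [pow_nonneg h0 2]
  · refine (div_le_self (zero_le_one.trans (P3_P2_facts hℓ3).1.le) hn1).trans_lt ?_
    rw [P3]; exact Real.rpow_lt_self_of_one_lt hP1 (by norm_num)

/-- For `1 ≤ n < P^{0.496}` (`𝓛 ≥ 4`): `T < P₂/n < P`. [cite: Zhang2022LandauSiegel, §2 (2.21)] -/
private theorem P2_div_window {D n : ℕ} (hℓ4 : 4 ≤ ell D) (hn : 1 ≤ n)
    (hnP : (n : ℝ) < bigP D ^ (0.496 : ℝ)) :
    bigT D < Skeleton.P2 D / n ∧ Skeleton.P2 D / n < bigP D := by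
  have hℓ3 : 3 ≤ ell D := by linarith
  have h1 : 1 ≤ ell D := by linarith
  have h0 : 0 ≤ ell D := by linarith
  have hP : 0 < bigP D := Real.exp_pos _
  have hP1 : 1 < bigP D := by
    rw [bigP]; exact Real.one_lt_exp_iff.mpr (pow_pos (by linarith) 9)
  have hn0 : (0 : ℝ) < n := by exact_mod_cast hn
  have hn1 : (1 : ℝ) ≤ n := by exact_mod_cast hn
  have hT0 : 0 < bigT D := Real.exp_pos _
  constructor
  · rw [lt_div_iff₀ hn0, Skeleton.P2, lt_div_iff₀ (pow_pos hT0 10)]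
    calc bigT D * n * bigT D ^ 10 < bigT D * bigP D ^ (0.496 : ℝ) * bigT D ^ 10 := by gcongr
      _ ≤ bigP D ^ (0.5 : ℝ) := by
          have hT11 : bigT D * bigP D ^ (0.496 : ℝ) * bigT D ^ 10 =
              Real.exp (11 * ell D ^ (1.1 : ℝ) + 0.496 * ell D ^ 9) := by
            rw [bigT, bigP, ← Real.exp_mul, ← Real.exp_nat_mul, ← Real.exp_add, ← Real.exp_add]
            ring_nf
          rw [hT11, show bigP D ^ (0.5 : ℝ) = Real.exp (0.5 * ell D ^ 9) by
              rw [bigP, ← Real.exp_mul]; ring_nf, Real.exp_le_exp]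
          have h11 := ell_rpow_le_sq h1
          have h7 : (4 : ℝ) ^ 7 ≤ ell D ^ 7 := pow_le_pow_left₀ (by norm_num) hℓ4 7
          nlinarith [pow_nonneg h0 2]
  · refine (div_le_self (zero_le_one.trans (P3_P2_facts hℓ3).2.2.1.le) hn1).trans_lt ?_
    calc Skeleton.P2 D ≤ bigP D ^ (0.5 : ℝ) := by
          rw [Skeleton.P2]
          exact div_le_self (Real.rpow_nonneg hP.le _)
            (one_le_pow₀ (Real.one_le_exp (Real.rpow_nonneg h0 _)))
      _ < bigP D := Real.rpow_lt_self_of_one_lt hP1 (by norm_num)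

/-- `1 + 2 log 2 ≤ 3`. [folklore] -/
private theorem one_add_two_log_two_le : 1 + 2 * Real.log 2 ≤ 3 := by
  have := Real.log_two_lt_d9; linarith

/-- `1 + E(1 + M) ≤ 3EM` for `E, M ≥ 1`. [folklore] -/
private theorem one_add_mul_le_three {E M : ℝ} (hE : 1 ≤ E) (hM : 1 ≤ M) :
    1 + E * (1 + M) ≤ 3 * E * M := by nlinarith

/-- `520·𝓛 ≤ 0.504·𝓛⁹` for `𝓛 ≥ 5`. [folklore] -/
private theorem aux520 {L : ℝ} (hL : 5 ≤ L) : 520 * L ≤ 0.504 * L ^ 9 := by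
  have h8 : (5 : ℝ) ^ 8 ≤ L ^ 8 := pow_le_pow_left₀ (by norm_num) hL 8
  nlinarith

/-! ### The edge `Lemma 10.1 ∧ Lemma 8.4 ⇒ Low1422Small` -/

/-- **Z22:§10.u049 (i) as an EDGE THEOREM.** [Z22 p.59, tex L3027] "By a result similar to Lemma 10.1
and the results in Section 8, the sum over `dr < P^{0.496}` is `o(α)`": `Skeleton.Lemma101 c′`
(Lemma 10.1, through its "simple modification" for the shifted tent = the substitution
`y ↦ y* = yP^{0.004}/(Dt₀)`, `mSum14 = 𝔳₁ⱼ(y*)`) and `Skeleton.Lemma84 c′` (Lemma 8.4, which evaluates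
the `n`-sum, `nSum22_eq_lemma84_sums`) imply `Typed.Sec10C.Low1422Small c′`. Quantitatively: for
`dr ≤ P^{0.496}Dt₀/T` one has `1 ≤ y* ≤ P^{0.5}/T` and `‖𝔳₁ⱼ(y*)‖ ≤ CT^{−c}` ((10.2)); on the remaining
window `y* ∈ (P^{0.5}/T, P^{0.5}]` of logarithmic length `≤ log T = 𝓛^{1.1}` only `‖𝔳₁ⱼ(y*)‖ ≤ C𝓛⁻⁷`
((10.5)); the `n`-sum is `≪ (dr/φ(dr))²𝓛⁻⁷` and the weights sum to `≪ (1 + log-length)`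
(`Skeleton.sum_ratio_pow_div_le`), whence the range sum is
`≪_{c′} e^{−c𝓛}𝓛² + 𝓛^{−14}(3 + 𝓛^{1.1}) = o(𝓛⁻⁹) = o(α)`. [cite: Zhang2022LandauSiegel, §10 p. 59] -/
theorem low1422Small_of (c' : ℝ) (h101 : Lemma101 c') (h84 : Lemma84 c') : Low1422Small c' := by
  intro ε hε
  obtain ⟨c, hc, C1, D1, H1⟩ := h101
  obtain ⟨C4, D4, H4⟩ := h84
  -- constants
  obtain ⟨G0, hG0def⟩ : ∃ G0 : ℝ, G0 = 1 + 8 / 9 * (3 * (1 + 5 * |c'| * π)) ^ 2 +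
      2 / 3 * (3 * (1 + 5 * |c'| * π) + 5 / 2) ^ 2 * π := ⟨_, rfl⟩
  have hG0 : 0 ≤ G0 := by rw [hG0def]; positivity
  obtain ⟨C4', hC4'⟩ : ∃ C4' : ℝ, C4' = max C4 0 := ⟨_, rfl⟩
  have hC4'0 : 0 ≤ C4' := by rw [hC4']; exact le_max_right _ _
  have hC44 : C4 ≤ C4' := by rw [hC4']; exact le_max_left _ _
  obtain ⟨C1', hC1'⟩ : ∃ C1' : ℝ, C1' = max C1 0 := ⟨_, rfl⟩
  have hC1'0 : 0 ≤ C1' := by rw [hC1']; exact le_max_right _ _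
  have hC11 : C1 ≤ C1' := by rw [hC1']; exact le_max_left _ _
  obtain ⟨KN, hKN⟩ : ∃ KN : ℝ,
      KN = (5 / 4 / 0.498 + 23 / 10 / 0.4) * (4 * Real.exp (9 / 2) * G0 + C4') := ⟨_, rfl⟩
  have hKN0 : 0 ≤ KN := by rw [hKN]; positivity
  obtain ⟨L1, hL1⟩ : ∃ L1 : ℝ,
      L1 = C1' * KN * Real.exp 256 * (3 * (Nat.factorial 12 : ℝ) / c ^ 12 + 4) / (ε * π) :=
    ⟨_, rfl⟩
  obtain ⟨L0, hL0⟩ : ∃ L0 : ℝ, L0 = max 5 L1 := ⟨_, rfl⟩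
  refine ⟨max (max D1 D4) ⌈Real.exp L0⌉₊, fun D _ χ hD hq hp hA j hj => ?_⟩
  have hD1 : D1 ≤ D := (le_max_left _ _).trans ((le_max_left _ _).trans hD)
  have hD4 : D4 ≤ D := (le_max_right _ _).trans ((le_max_left _ _).trans hD)
  have hℓL0 : L0 ≤ ell D := le_ell_of_ceil_exp_le (le_of_max_le_right hD)
  have hℓ5 : 5 ≤ ell D := by rw [hL0] at hℓL0; exact (le_max_left _ _).trans hℓL0
  have hℓL1 : L1 ≤ ell D := by rw [hL0] at hℓL0; exact (le_max_right _ _).trans hℓL0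
  have hℓ4 : 4 ≤ ell D := by linarith
  have hℓ3 : 3 ≤ ell D := by linarith
  have h1 : 1 ≤ ell D := by linarith
  have h0 : 0 < ell D := by linarith
  have hD2 : 2 ≤ D := two_le_of_ell hℓ3
  have H1D := H1 D χ hD1 hq hp hA j hj
  have H4D := H4 D χ hD4 hq hp hA j hj
  -- sizes
  have hP : 0 < bigP D := Real.exp_pos _
  have hP1 : 1 < bigP D := by rw [bigP]; exact Real.one_lt_exp_iff.mpr (by positivity)
  have hT0 : 0 < bigT D := Real.exp_pos _
  have hDt1 : 1 ≤ (D : ℝ) * t0 D := one_le_D_mul_t0 h1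
  have hDt0 : 0 < (D : ℝ) * t0 D := by linarith
  have hDtP : (D : ℝ) * t0 D ≤ bigP D ^ (0.004 : ℝ) := D_mul_t0_le_rpow hℓ5
  have hP4 : 0 < bigP D ^ (0.004 : ℝ) := Real.rpow_pos_of_pos hP _
  have hP496 : 0 < bigP D ^ (0.496 : ℝ) := Real.rpow_pos_of_pos hP _
  have hPsplit : bigP D ^ (0.496 : ℝ) * bigP D ^ (0.004 : ℝ) = bigP D ^ (0.5 : ℝ) := by
    rw [← Real.rpow_add hP]; norm_num
  -- the cut point `W = P^{0.496}·Dt₀/T`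
  obtain ⟨W, hW⟩ : ∃ W : ℝ, W = bigP D ^ (0.496 : ℝ) * ((D : ℝ) * t0 D) / bigT D := ⟨_, rfl⟩
  have hPT : bigT D ≤ bigP D ^ (0.496 : ℝ) := bigT_le_rpow496 hℓ3
  have hW1 : 1 ≤ W := by
    rw [hW, le_div_iff₀ hT0, one_mul]
    calc bigT D ≤ bigP D ^ (0.496 : ℝ) * 1 := by rw [mul_one]; exact hPT
      _ ≤ bigP D ^ (0.496 : ℝ) * ((D : ℝ) * t0 D) := by gcongr
  -- `y* = yShift D n` on the range
  have hys : ∀ n : ℕ, yShift D n = (n : ℝ) * bigP D ^ (0.004 : ℝ) / ((D : ℝ) * t0 D) := fun n => rfl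
  have hy1 : ∀ n : ℕ, 1 ≤ n → 1 ≤ yShift D n := by
    intro n hn
    rw [hys, le_div_iff₀ hDt0, one_mul]
    calc (D : ℝ) * t0 D ≤ bigP D ^ (0.004 : ℝ) := hDtP
      _ = 1 * bigP D ^ (0.004 : ℝ) := (one_mul _).symm
      _ ≤ (n : ℝ) * bigP D ^ (0.004 : ℝ) := by gcongr; exact_mod_cast hn
  have hy5 : ∀ n : ℕ, (n : ℝ) < bigP D ^ (0.496 : ℝ) → yShift D n ≤ bigP D ^ (0.5 : ℝ) := by
    intro n hn
    rw [hys, div_le_iff₀ hDt0, ← hPsplit]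
    calc (n : ℝ) * bigP D ^ (0.004 : ℝ) ≤ bigP D ^ (0.496 : ℝ) * bigP D ^ (0.004 : ℝ) := by
          gcongr
      _ = bigP D ^ (0.496 : ℝ) * bigP D ^ (0.004 : ℝ) * 1 := (mul_one _).symm
      _ ≤ bigP D ^ (0.496 : ℝ) * bigP D ^ (0.004 : ℝ) * ((D : ℝ) * t0 D) := by gcongr
  have hyW : ∀ n : ℕ, (n : ℝ) ≤ W → yShift D n ≤ bigP D ^ (0.5 : ℝ) / bigT D := by
    intro n hn
    rw [hys, div_le_iff₀ hDt0, div_mul_eq_mul_div, le_div_iff₀ hT0, ← hPsplit]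
    rw [hW, le_div_iff₀ hT0] at hn
    calc (n : ℝ) * bigP D ^ (0.004 : ℝ) * bigT D = (n : ℝ) * bigT D * bigP D ^ (0.004 : ℝ) := by ring
      _ ≤ bigP D ^ (0.496 : ℝ) * ((D : ℝ) * t0 D) * bigP D ^ (0.004 : ℝ) := by gcongr
      _ = bigP D ^ (0.496 : ℝ) * bigP D ^ (0.004 : ℝ) * ((D : ℝ) * t0 D) := by ring
  have hyW' : ∀ n : ℕ, ¬ (n : ℝ) ≤ W → bigP D ^ (0.5 : ℝ) / bigT D < yShift D n := by
    intro n hn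
    have hn' : W < n := not_le.mp hn
    rw [hys, lt_div_iff₀ hDt0, div_mul_eq_mul_div, div_lt_iff₀ hT0, ← hPsplit]
    rw [hW, div_lt_iff₀ hT0] at hn'
    calc bigP D ^ (0.496 : ℝ) * bigP D ^ (0.004 : ℝ) * ((D : ℝ) * t0 D)
        = bigP D ^ (0.496 : ℝ) * ((D : ℝ) * t0 D) * bigP D ^ (0.004 : ℝ) := by ring
      _ < (n : ℝ) * bigT D * bigP D ^ (0.004 : ℝ) := by gcongr
      _ = (n : ℝ) * bigP D ^ (0.004 : ℝ) * bigT D := by ring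
  -- the `m`-sum bound per `n`
  have hMmain : ∀ n : ℕ, 1 ≤ n → (n : ℝ) < bigP D ^ (0.496 : ℝ) → (n : ℝ) ≤ W →
      ‖frakv1 c' χ j (yShift D n)‖ ≤ C1' * bigT D ^ (-c) := by
    intro n hn _ hnW
    exact ((H1D (yShift D n)).1 (hy1 n hn) (hyW n hnW)).trans
      (mul_le_mul_of_nonneg_right hC11 (Real.rpow_nonneg hT0.le _))
  have hMwin : ∀ n : ℕ, 1 ≤ n → (n : ℝ) < bigP D ^ (0.496 : ℝ) → ¬ (n : ℝ) ≤ W →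
      ‖frakv1 c' χ j (yShift D n)‖ ≤ C1' * (ell D ^ 7)⁻¹ := by
    intro n hn hnP hnW
    exact ((H1D (yShift D n)).2.2.2 (Or.inl ⟨hyW' n hnW, hy5 n hnP⟩)).trans
      (mul_le_mul_of_nonneg_right hC11 (by positivity))
  -- the `n`-sum bound per `(n/r, r)`
  have hG : ∀ μ : ℕ, ∀ y : ℝ, |Real.log y| ≤ ell D ^ 9 → ‖frakgW c' D j μ y‖ ≤ G0 := by
    intro μ y hy
    rw [hG0def]
    exact Section9Discharge.norm_frakgW_le (c' := c') h1 j μ hy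
  have h504N := Sec10B.rpow504_le_nsuppBound hℓ3
  have hN : ∀ n : ℕ, 1 ≤ n → (n : ℝ) < bigP D ^ (0.496 : ℝ) → ∀ r ∈ n.divisors,
      ‖Sec10C.nSum22 c' χ j (n / r) r‖ ≤ ((n : ℝ) / Nat.totient n) ^ 2 * (KN / ell D ^ 7) := by
    intro n hn hnP r hr
    have hrn : r ∣ n := Nat.dvd_of_mem_divisors hr
    have hr1 : 1 ≤ r := Nat.pos_of_mem_divisors hr
    have hdr : n / r * r = n := Nat.div_mul_cancel hrn
    have hd1 : 1 ≤ n / r := Nat.div_pos (Nat.le_of_dvd hn hrn) hr1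
    have hdrR : ((n / r * r : ℕ) : ℝ) = n := by rw [hdr]
    have hdrP : ((n / r * r : ℕ) : ℝ) < bigP D ^ (0.496 : ℝ) := by rw [hdrR]; exact hnP
    have hdrN : ((n / r * r : ℕ) : ℝ) < bigP D / bigT D ^ 2 := by
      rw [hdrR]
      exact hnP.trans_le ((Real.rpow_le_rpow_of_exponent_le hP1.le (by norm_num)).trans h504N)
    -- Lemma 8.4 at the two points
    obtain ⟨hy3T, hy3P⟩ := P3_div_window hℓ3 hn hnP
    obtain ⟨hy2T, hy2P⟩ := P2_div_window hℓ4 hn hnP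
    rw [← hdrR] at hy3T hy3P hy2T hy2P
    have h6 := H4D 6 (by simp) (n / r) r hd1 hr1 hdrN _ hy3T hy3P
    have h7 := H4D 7 (by simp) (n / r) r hd1 hr1 hdrN _ hy2T hy2P
    have hw6 := h6.trans (mul_le_mul_of_nonneg_right hC44 (by positivity))
    have hw7 := h7.trans (mul_le_mul_of_nonneg_right hC44 (by positivity))
    have key := norm_nSum22_le c' χ hℓ4 hp hC4'0 hG0 j hG hd1 hr1 hdrP hw6 hw7
    rw [hdr, ← hKN] at key
    calc ‖Sec10C.nSum22 c' χ j (n / r) r‖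
        ≤ ((n : ℝ) / Nat.totient n) ^ 2 * KN / ell D ^ 7 := by exact_mod_cast key
      _ = ((n : ℝ) / Nat.totient n) ^ 2 * (KN / ell D ^ 7) := by ring
  -- the `m`-sum per `(n/r, r)` is `𝔳₁ⱼ(y*(n))`
  have hMeq : ∀ n : ℕ, 1 ≤ n → ∀ r ∈ n.divisors,
      Sec10C.mSum14 c' χ j (n / r) r = frakv1 c' χ j (yShift D n) := by
    intro n hn r hr
    have hrn : r ∣ n := Nat.dvd_of_mem_divisors hr
    have hr1 : 1 ≤ r := Nat.pos_of_mem_divisors hr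
    have hd1 : 1 ≤ n / r := Nat.div_pos (Nat.le_of_dvd hn hrn) hr1
    rw [Sec10C.mSum14_eq_frakv1_yShift c' χ hℓ3 j hd1 hr1, Nat.div_mul_cancel hrn]
  -- assemble
  set F : Finset ℕ := (Finset.Ico 1 (Nsupp D)).filter
    (fun n : ℕ => (0 : ℝ) ≤ (n : ℝ) ∧ (n : ℝ) < bigP D ^ (0.496 : ℝ)) with hF
  have hFmem : ∀ n ∈ F, 1 ≤ n ∧ (n : ℝ) < bigP D ^ (0.496 : ℝ) := by
    intro n hn
    rw [hF, Finset.mem_filter, Finset.mem_Ico] at hn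
    exact ⟨hn.1.1, hn.2.2⟩
  -- per-`n` bound with the two-valued `M`
  have hper : ∀ n ∈ F, ∑ r ∈ n.divisors, ‖term1422 c' χ j (n / r) r‖ ≤
      ((n : ℝ) / Nat.totient n) ^ 7 / n *
        (if (n : ℝ) ≤ W then C1' * bigT D ^ (-c) else C1' * (ell D ^ 7)⁻¹) * (KN / ell D ^ 7) := by
    intro n hn
    obtain ⟨hn1, hnP⟩ := hFmem n hn
    refine sum_divisors_term1422_le c' χ j (by omega) (by split_ifs <;> positivity)
      (fun r hr => ?_) (hN n hn1 hnP)
    rw [hMeq n hn1 r hr]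
    split_ifs with hnW
    · exact hMmain n hn1 hnP hnW
    · exact hMwin n hn1 hnP hnW
  have hS : ‖S1422On c' χ j 0 (bigP D ^ (0.496 : ℝ))‖ ≤
      C1' * bigT D ^ (-c) * (KN / ell D ^ 7) * (1 + Real.exp 256 * (1 + Real.log W)) +
        C1' * (ell D ^ 7)⁻¹ * (KN / ell D ^ 7) *
          (Real.exp 256 * (1 + 2 * Real.log 2 +
            max 0 (Real.log (bigP D ^ (0.496 : ℝ)) - Real.log W))) := by
    rw [S1422On_low_eq c' χ hℓ3 j, ← hF]
    calc ‖∑ n ∈ F, ∑ r ∈ n.divisors, term1422 c' χ j (n / r) r‖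
        ≤ ∑ n ∈ F, ‖∑ r ∈ n.divisors, term1422 c' χ j (n / r) r‖ := norm_sum_le _ _
      _ ≤ ∑ n ∈ F, ∑ r ∈ n.divisors, ‖term1422 c' χ j (n / r) r‖ :=
          Finset.sum_le_sum fun n _ => norm_sum_le _ _
      _ ≤ ∑ n ∈ F, ((n : ℝ) / Nat.totient n) ^ 7 / n *
            (if (n : ℝ) ≤ W then C1' * bigT D ^ (-c) else C1' * (ell D ^ 7)⁻¹) *
              (KN / ell D ^ 7) := Finset.sum_le_sum hper
      _ = C1' * bigT D ^ (-c) * (KN / ell D ^ 7) *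
              ∑ n ∈ F.filter (fun n : ℕ => (n : ℝ) ≤ W), ((n : ℝ) / Nat.totient n) ^ 7 / n +
            C1' * (ell D ^ 7)⁻¹ * (KN / ell D ^ 7) *
              ∑ n ∈ F.filter (fun n : ℕ => ¬ (n : ℝ) ≤ W), ((n : ℝ) / Nat.totient n) ^ 7 / n := by
          rw [← Finset.sum_filter_add_sum_filter_not F (fun n : ℕ => (n : ℝ) ≤ W), Finset.mul_sum,
            Finset.mul_sum]
          congr 1
          · refine Finset.sum_congr rfl fun n hn => ?_
            rw [Finset.mem_filter] at hn
            rw [if_pos hn.2]; ring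
          · refine Finset.sum_congr rfl fun n hn => ?_
            rw [Finset.mem_filter] at hn
            rw [if_neg hn.2]; ring
      _ ≤ _ := by
          gcongr
          · exact sum_main_le F (fun n hn => (hFmem n hn).1) hW1
          · exact sum_window_le F (Real.one_le_rpow hP1.le (by norm_num)) hFmem hW1
  -- sizes of the logarithms involved
  have hαeq : alpha D = π / ell D ^ 9 := by rw [alpha, log_bigP]
  have hlogW : Real.log W =
      0.496 * ell D ^ 9 + Real.log ((D : ℝ) * t0 D) - ell D ^ (1.1 : ℝ) := by
    rw [hW, Real.log_div (by positivity) hT0.ne', Real.log_mul hP496.ne' hDt0.ne', log_bigP_rpow,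
      log_bigT]
  have hlogDt0 : 0 ≤ Real.log ((D : ℝ) * t0 D) := Real.log_nonneg hDt1
  have hlogDt : Real.log ((D : ℝ) * t0 D) ≤ 520 * ell D := by
    have h := Real.log_le_log hDt0 (D_mul_t0_le h1)
    rwa [Real.log_exp] at h
  have h520 := aux520 hℓ5
  have hrp0 : 0 ≤ ell D ^ (1.1 : ℝ) := Real.rpow_nonneg h0.le _
  have hW9 : Real.log W ≤ ell D ^ 9 := by rw [hlogW]; linarith
  have hW9' : 1 + Real.log W ≤ 1 + ell D ^ 9 := by linarith
  have hmax : max 0 (Real.log (bigP D ^ (0.496 : ℝ)) - Real.log W) ≤ ell D ^ 2 := by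
    rw [max_le_iff, log_bigP_rpow, hlogW]
    have h11 := ell_rpow_le_sq h1
    constructor
    · positivity
    · linarith
  have hwin : 1 + 2 * Real.log 2 + max 0 (Real.log (bigP D ^ (0.496 : ℝ)) - Real.log W) ≤
      3 + ell D ^ 2 := by linarith [one_add_two_log_two_le]
  have hTc : bigT D ^ (-c) ≤ Real.exp (-(c * ell D)) := by
    rw [bigT, ← Real.exp_mul, Real.exp_le_exp]
    have h := mul_le_mul_of_nonneg_left (ell_le_rpow h1) hc.le
    linarith
  have hE1 : (1 : ℝ) ≤ Real.exp 256 := Real.one_le_exp (by norm_num)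
  have hL9 : (1 : ℝ) ≤ ell D ^ 9 := one_le_pow₀ h1
  have hmainpoly := one_add_mul_le_three hE1 hL9
  have hfin := closing_bound (K := C1' * KN) (mul_nonneg hC1'0 hKN0) hc hε h1
    (by rw [hL1] at hℓL1; exact hℓL1)
  have hl7 : 0 < ell D ^ 7 := by positivity
  calc ‖S1422On c' χ j 0 (bigP D ^ (0.496 : ℝ))‖
      ≤ _ := hS
    _ ≤ C1' * Real.exp (-(c * ell D)) * (KN / ell D ^ 7) * (1 + Real.exp 256 * (1 + ell D ^ 9)) +
          C1' * (ell D ^ 7)⁻¹ * (KN / ell D ^ 7) * (Real.exp 256 * (3 + ell D ^ 2)) := by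
        have hlogW0 : 0 ≤ Real.log W := Real.log_nonneg hW1
        gcongr
    _ ≤ C1' * Real.exp (-(c * ell D)) * (KN / ell D ^ 7) * (3 * Real.exp 256 * ell D ^ 9) +
          C1' * (ell D ^ 7)⁻¹ * (KN / ell D ^ 7) * (Real.exp 256 * (3 + ell D ^ 2)) := by
        gcongr
    _ = C1' * KN * (3 * Real.exp 256 * ell D ^ 11 * Real.exp (-(c * ell D)) +
          Real.exp 256 * (3 + ell D ^ 2) / ell D ^ 5) / ell D ^ 9 := by
        field_simp
    _ ≤ ε * π / ell D ^ 9 := by gcongr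
    _ = ε * alpha D := by rw [hαeq]; ring


/-- **Z22:§10.u049 (i) modulo Lemma 8.4 only** (for the manuscript's parameter range `c′ ≥ 0`):
Lemma 10.1 is a theorem of the tree (sz-d45's `Skeleton.lemma101_holds`), so the low range of
`S_j(𝐚₁₄,𝐚₂₂)` is `o(α)` as soon as Lemma 8.4 (`Skeleton.Lemma84 c′`, the banked CLAIM leaf proved in
the manuscript's Appendix A) holds. [cite: Zhang2022LandauSiegel, §10 p. 59] -/
theorem low1422Small_of_lemma84 {c' : ℝ} (hc' : 0 ≤ c') (h84 : Lemma84 c') : Low1422Small c' :=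
  low1422Small_of c' (lemma101_holds hc') h84


/-! ### The same edge from the RELATIVE Lemma 8.4 (`Skeleton.Lemma84Rel`) — ZHANG-L discharge lane

The absolute Lemma 8.4 (`Skeleton.Lemma84`) is not in the cone of `Skeleton.theorem1_of_leaves_v19`
(GAP row G-adj1-1: its printed `O(𝓛⁻⁶)` is not derivable uniformly in `(d,r)`); what the cone carries
is the relative form `Skeleton.Lemma84Rel` (error `C𝓛⁻⁶·(∏_{q∣dr}(1−q⁻¹)⁻¹)² = C𝓛⁻⁶(dr/φ(dr))²`,
`Skeleton.lemma84Rel_of_lemma83Rel`). Running the argument of `low1422Small_of` with this error costs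
two more powers of `n/φ(n)` in the weights — `(n/φ(n))⁹` instead of `(n/φ(n))⁷`, constant `e¹⁰²⁴`
instead of `e²⁵⁶` in d41's `Skeleton.sum_ratio_pow_div_le` — and nothing else (seat zl-w10-p2, WP10;
consumer: the v19 leaf `Typed.Sec10C.Gather1422` via `gather1422_of_ranges`). -/

/-- `∏_{q∣n}(1 − q⁻¹)⁻¹ = n/φ(n)` (`n ≠ 0`; Euler's product, d41's `Skeleton.self_div_totient_eq_prod`).
[cite: Zhang2022LandauSiegel, §10 p. 59] -/
private theorem prod_one_sub_inv_inv_eq_ratio {n : ℕ} (hn : n ≠ 0) :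
    ∏ q ∈ n.primeFactors, (1 - (q : ℝ)⁻¹)⁻¹ = (n : ℝ) / Nat.totient n := by
  rw [self_div_totient_eq_prod hn]
  refine Finset.prod_congr rfl fun q hq => ?_
  have h2 : (2 : ℝ) ≤ q := by exact_mod_cast (Nat.prime_of_mem_primeFactors hq).two_le
  have hq0 : (q : ℝ) ≠ 0 := by linarith
  have hq1 : (q : ℝ) - 1 ≠ 0 := by linarith
  field_simp

/-- `Σ_{1 ≤ n ≤ X} (n/φ(n))⁹/n ≤ 1 + e¹⁰²⁴(1 + log X)` (`X ≥ 1`; the `n = 1` term plus d41's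
`Skeleton.sum_ratio_pow_div_le 9` on `(1, X]`). [cite: Zhang2022LandauSiegel, §10 p. 59] -/
private theorem sum_Icc_ratio9_le {X : ℕ} (hX : 1 ≤ X) :
    ∑ n ∈ Finset.Icc 1 X, ((n : ℝ) / Nat.totient n) ^ 9 / n ≤
      1 + Real.exp 1024 * (1 + Real.log X) := by
  rw [Finset.Icc_eq_cons_Ioc hX, Finset.sum_cons]
  have h1 : (((1 : ℕ) : ℝ) / Nat.totient 1) ^ 9 / ((1 : ℕ) : ℝ) = 1 := by simp
  rw [h1]
  have h := sum_ratio_pow_div_le 9 (Y := 1) (X := X) one_pos hX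
  simp only [Nat.cast_one, Real.log_one, sub_zero] at h
  have h1024 : (2 : ℝ) ^ (9 + 1) = 1024 := by norm_num
  rw [h1024] at h
  linarith

/-- `Σ_{Y < n ≤ X} (n/φ(n))⁹/n ≤ e¹⁰²⁴(1 + log X − log Y)` (`1 ≤ Y ≤ X`; d41's lemma with `k = 9`).
[cite: Zhang2022LandauSiegel, §10 p. 59] -/
private theorem sum_Ioc_ratio9_le {Y X : ℕ} (hY : 0 < Y) (hYX : Y ≤ X) :
    ∑ n ∈ Finset.Ioc Y X, ((n : ℝ) / Nat.totient n) ^ 9 / n ≤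
      Real.exp 1024 * (1 + Real.log X - Real.log Y) := by
  have h := sum_ratio_pow_div_le 9 hY hYX
  have h1024 : (2 : ℝ) ^ (9 + 1) = 1024 := by norm_num
  rwa [h1024] at h

/-- The closing numerical step with the constant `e¹⁰²⁴`: for `L ≥ 1` with
`K·e¹⁰²⁴(3·12!/c¹² + 4)/(επ) ≤ L`, `K(3e¹⁰²⁴L¹¹e^{−cL} + e¹⁰²⁴(3 + L²)L⁻⁵) ≤ επ`. [folklore] -/
private theorem closing_bound9 {K c ε L : ℝ} (hK : 0 ≤ K) (hc : 0 < c) (hε : 0 < ε) (hL1 : 1 ≤ L)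
    (hL : K * Real.exp 1024 * (3 * (Nat.factorial 12 : ℝ) / c ^ 12 + 4) / (ε * π) ≤ L) :
    K * (3 * Real.exp 1024 * L ^ 11 * Real.exp (-(c * L)) + Real.exp 1024 * (3 + L ^ 2) / L ^ 5) ≤
      ε * π := by
  have hL0 : 0 < L := by linarith
  have hπ := Real.pi_pos
  have hεπ : 0 < ε * π := by positivity
  have h1 : L ^ 11 * Real.exp (-(c * L)) ≤ (Nat.factorial 12 : ℝ) / (c ^ 12 * L) := by
    rw [mul_comm]; exact exp_neg_mul_pow_eleven_le hc hL0
  have h2 : (3 + L ^ 2) / L ^ 5 ≤ 4 / L := by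
    rw [div_le_div_iff₀ (by positivity) hL0]
    have hL2 : 1 ≤ L ^ 2 := one_le_pow₀ hL1
    have hL4 : L ^ 2 ≤ L ^ 4 := pow_le_pow_right₀ hL1 (by norm_num)
    nlinarith
  have hmain : K * (3 * Real.exp 1024 * L ^ 11 * Real.exp (-(c * L)) +
      Real.exp 1024 * (3 + L ^ 2) / L ^ 5) ≤
      K * Real.exp 1024 * (3 * (Nat.factorial 12 : ℝ) / c ^ 12 + 4) / L := by
    have e1024 : 0 < Real.exp 1024 := Real.exp_pos _
    calc K * (3 * Real.exp 1024 * L ^ 11 * Real.exp (-(c * L)) + Real.exp 1024 * (3 + L ^ 2) / L ^ 5)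
        = K * (3 * Real.exp 1024 * (L ^ 11 * Real.exp (-(c * L))) +
            Real.exp 1024 * ((3 + L ^ 2) / L ^ 5)) := by ring
      _ ≤ K * (3 * Real.exp 1024 * ((Nat.factorial 12 : ℝ) / (c ^ 12 * L)) +
            Real.exp 1024 * (4 / L)) := by gcongr
      _ = K * Real.exp 1024 * (3 * (Nat.factorial 12 : ℝ) / c ^ 12 + 4) / L := by
          field_simp
  refine hmain.trans ?_
  rw [div_le_iff₀ hL0]
  rw [div_le_iff₀ hεπ] at hL
  linarith

/-- Main range, weight `(n/φ(n))⁹`: `Σ_{n ∈ F, n ≤ W} (n/φ(n))⁹/n ≤ 1 + e¹⁰²⁴(1 + log W)` for `W ≥ 1`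
and any `F ⊆ [1, ∞)`. [cite: Zhang2022LandauSiegel, §10 p. 59] -/
private theorem sum_main_le9 (F : Finset ℕ) (hF : ∀ n ∈ F, 1 ≤ n) {W : ℝ} (hW : 1 ≤ W) :
    ∑ n ∈ F.filter (fun n : ℕ => (n : ℝ) ≤ W), ((n : ℝ) / Nat.totient n) ^ 9 / n ≤
      1 + Real.exp 1024 * (1 + Real.log W) := by
  have hW1 : 1 ≤ ⌊W⌋₊ := Nat.le_floor (by exact_mod_cast hW)
  have hsub : F.filter (fun n : ℕ => (n : ℝ) ≤ W) ⊆ Finset.Icc 1 ⌊W⌋₊ := by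
    intro n hn
    rw [Finset.mem_filter] at hn
    rw [Finset.mem_Icc]
    exact ⟨hF n hn.1, Nat.le_floor hn.2⟩
  calc ∑ n ∈ F.filter (fun n : ℕ => (n : ℝ) ≤ W), ((n : ℝ) / Nat.totient n) ^ 9 / n
      ≤ ∑ n ∈ Finset.Icc 1 ⌊W⌋₊, ((n : ℝ) / Nat.totient n) ^ 9 / n :=
        Finset.sum_le_sum_of_subset_of_nonneg hsub fun n _ _ => by positivity
    _ ≤ 1 + Real.exp 1024 * (1 + Real.log (⌊W⌋₊ : ℕ)) := sum_Icc_ratio9_le hW1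
    _ ≤ 1 + Real.exp 1024 * (1 + Real.log W) := by
        gcongr
        exact Nat.floor_le (by linarith)

/-- Window, weight `(n/φ(n))⁹`: `Σ_{n ∈ F, n > W} (n/φ(n))⁹/n ≤ e¹⁰²⁴(1 + 2 log 2 + max 0 (log X − log W))`
for `W ≥ 1`, `X ≥ 1` and any `F ⊆ [1, X)`. [cite: Zhang2022LandauSiegel, §10 p. 59] -/
private theorem sum_window_le9 (F : Finset ℕ) {X : ℝ} (hX : 1 ≤ X)
    (hF : ∀ n ∈ F, 1 ≤ n ∧ (n : ℝ) < X) {W : ℝ} (hW : 1 ≤ W) :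
    ∑ n ∈ F.filter (fun n : ℕ => ¬ (n : ℝ) ≤ W), ((n : ℝ) / Nat.totient n) ^ 9 / n ≤
      Real.exp 1024 * (1 + 2 * Real.log 2 + max 0 (Real.log X - Real.log W)) := by
  have hlog2 : 0 < Real.log 2 := Real.log_pos (by norm_num)
  by_cases hWX : W ≤ X
  · have hY : 0 < ⌊W⌋₊ := Nat.floor_pos.mpr hW
    have hYX : ⌊W⌋₊ ≤ ⌈X⌉₊ := (Nat.floor_le_floor hWX).trans (Nat.floor_le_ceil X)
    have hsub : F.filter (fun n : ℕ => ¬ (n : ℝ) ≤ W) ⊆ Finset.Ioc ⌊W⌋₊ ⌈X⌉₊ := by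
      intro n hn
      rw [Finset.mem_filter] at hn
      rw [Finset.mem_Ioc]
      constructor
      · have h1 : (⌊W⌋₊ : ℝ) ≤ W := Nat.floor_le (by linarith)
        have h2 : W < n := not_le.mp hn.2
        exact_mod_cast h1.trans_lt h2
      · have := (hF n hn.1).2
        exact Nat.cast_le.mp ((this.le.trans (Nat.le_ceil X)).trans_eq (by norm_cast))
    calc ∑ n ∈ F.filter (fun n : ℕ => ¬ (n : ℝ) ≤ W), ((n : ℝ) / Nat.totient n) ^ 9 / n
        ≤ ∑ n ∈ Finset.Ioc ⌊W⌋₊ ⌈X⌉₊, ((n : ℝ) / Nat.totient n) ^ 9 / n :=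
          Finset.sum_le_sum_of_subset_of_nonneg hsub fun n _ _ => by positivity
      _ ≤ Real.exp 1024 * (1 + Real.log (⌈X⌉₊ : ℕ) - Real.log (⌊W⌋₊ : ℕ)) := sum_Ioc_ratio9_le hY hYX
      _ ≤ Real.exp 1024 * (1 + 2 * Real.log 2 + max 0 (Real.log X - Real.log W)) := by
          gcongr
          -- `log⌈X⌉ ≤ log X + log 2`, `log⌊W⌋ ≥ log W − log 2`
          have hc : (⌈X⌉₊ : ℝ) ≤ 2 * X := by
            have := Nat.ceil_lt_add_one (by linarith : (0 : ℝ) ≤ X)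
            linarith
          have hf : W / 2 ≤ (⌊W⌋₊ : ℝ) := by
            rcases le_or_gt 2 W with h2 | h2
            · have := Nat.lt_floor_add_one W
              linarith
            · have : (1 : ℝ) ≤ ⌊W⌋₊ := by exact_mod_cast hY
              linarith
          have h1 : Real.log (⌈X⌉₊ : ℕ) ≤ Real.log 2 + Real.log X := by
            rw [← Real.log_mul (by norm_num) (by linarith)]
            exact Real.log_le_log (by exact_mod_cast (lt_of_lt_of_le hY hYX)) hc
          have h2 : Real.log W - Real.log 2 ≤ Real.log (⌊W⌋₊ : ℕ) := by
            rw [← Real.log_div (by linarith) (by norm_num)]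
            exact Real.log_le_log (by linarith) hf
          have h3 : Real.log X - Real.log W ≤ max 0 (Real.log X - Real.log W) := le_max_right _ _
          linarith
  · have hempty : F.filter (fun n : ℕ => ¬ (n : ℝ) ≤ W) = ∅ := by
      rw [Finset.filter_eq_empty_iff]
      intro n hn h
      exact h (((hF n hn).2.le.trans (not_le.mp hWX).le))
    rw [hempty, Finset.sum_empty]
    have : 0 ≤ max 0 (Real.log X - Real.log W) := le_max_left _ _
    positivity

/-- **Z22:§10.u049 (i) as an EDGE THEOREM over the RELATIVE Lemma 8.4.** [Z22 p.59, tex L3027]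
"By a result similar to Lemma 10.1 and the results in Section 8, the sum over `dr < P^{0.496}` is
`o(α)`": `Skeleton.Lemma101 c′` and `Skeleton.Lemma84Rel c′` (Lemma 8.4 with the error
`O(𝓛⁻⁶)·(∏_{q∣dr}(1−q⁻¹)⁻¹)² = O(𝓛⁻⁶)(dr/φ(dr))²` that its Appendix-A proof delivers,
`Skeleton.lemma84Rel_of_lemma83Rel`) imply `Typed.Sec10C.Low1422Small c′`. Same proof as
`low1422Small_of`: the relative error only turns the bound `‖n-sum‖ ≤ (n/φ(n))²K_N𝓛⁻⁷` into
`‖n-sum‖ ≤ (n/φ(n))⁴K_N𝓛⁻⁷` (`norm_nSum22_le` applied with the constant `C₈₄(n/φ(n))²`), so the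
weights are summed with `(n/φ(n))⁹` (`Skeleton.sum_ratio_pow_div_le 9`, constant `e¹⁰²⁴`); the range
sum is again `≪_{c′} e^{−c𝓛}𝓛² + 𝓛^{−14}(3 + 𝓛^{1.1}) = o(α)`. [cite: Zhang2022LandauSiegel, §10 p. 59] -/
theorem low1422Small_of_rel (c' : ℝ) (h101 : Lemma101 c') (h84 : Lemma84Rel c') :
    Low1422Small c' := by
  intro ε hε
  obtain ⟨c, hc, C1, D1, H1⟩ := h101
  obtain ⟨C4, D4, H4⟩ := h84
  -- constants
  obtain ⟨G0, hG0def⟩ : ∃ G0 : ℝ, G0 = 1 + 8 / 9 * (3 * (1 + 5 * |c'| * π)) ^ 2 +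
      2 / 3 * (3 * (1 + 5 * |c'| * π) + 5 / 2) ^ 2 * π := ⟨_, rfl⟩
  have hG0 : 0 ≤ G0 := by rw [hG0def]; positivity
  obtain ⟨C4', hC4'⟩ : ∃ C4' : ℝ, C4' = max C4 0 := ⟨_, rfl⟩
  have hC4'0 : 0 ≤ C4' := by rw [hC4']; exact le_max_right _ _
  have hC44 : C4 ≤ C4' := by rw [hC4']; exact le_max_left _ _
  obtain ⟨C1', hC1'⟩ : ∃ C1' : ℝ, C1' = max C1 0 := ⟨_, rfl⟩
  have hC1'0 : 0 ≤ C1' := by rw [hC1']; exact le_max_right _ _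
  have hC11 : C1 ≤ C1' := by rw [hC1']; exact le_max_left _ _
  obtain ⟨KN, hKN⟩ : ∃ KN : ℝ,
      KN = (5 / 4 / 0.498 + 23 / 10 / 0.4) * (4 * Real.exp (9 / 2) * G0 + C4') := ⟨_, rfl⟩
  have hKN0 : 0 ≤ KN := by rw [hKN]; positivity
  obtain ⟨L1, hL1⟩ : ∃ L1 : ℝ,
      L1 = C1' * KN * Real.exp 1024 * (3 * (Nat.factorial 12 : ℝ) / c ^ 12 + 4) / (ε * π) :=
    ⟨_, rfl⟩
  obtain ⟨L0, hL0⟩ : ∃ L0 : ℝ, L0 = max 5 L1 := ⟨_, rfl⟩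
  refine ⟨max (max D1 D4) ⌈Real.exp L0⌉₊, fun D _ χ hD hq hp hA j hj => ?_⟩
  have hD1 : D1 ≤ D := (le_max_left _ _).trans ((le_max_left _ _).trans hD)
  have hD4 : D4 ≤ D := (le_max_right _ _).trans ((le_max_left _ _).trans hD)
  have hℓL0 : L0 ≤ ell D := le_ell_of_ceil_exp_le (le_of_max_le_right hD)
  have hℓ5 : 5 ≤ ell D := by rw [hL0] at hℓL0; exact (le_max_left _ _).trans hℓL0
  have hℓL1 : L1 ≤ ell D := by rw [hL0] at hℓL0; exact (le_max_right _ _).trans hℓL0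
  have hℓ4 : 4 ≤ ell D := by linarith
  have hℓ3 : 3 ≤ ell D := by linarith
  have h1 : 1 ≤ ell D := by linarith
  have h0 : 0 < ell D := by linarith
  have hD2 : 2 ≤ D := two_le_of_ell hℓ3
  have H1D := H1 D χ hD1 hq hp hA j hj
  have H4D := H4 D χ hD4 hq hp hA j hj
  -- sizes
  have hP : 0 < bigP D := Real.exp_pos _
  have hP1 : 1 < bigP D := by rw [bigP]; exact Real.one_lt_exp_iff.mpr (by positivity)
  have hT0 : 0 < bigT D := Real.exp_pos _
  have hDt1 : 1 ≤ (D : ℝ) * t0 D := one_le_D_mul_t0 h1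
  have hDt0 : 0 < (D : ℝ) * t0 D := by linarith
  have hDtP : (D : ℝ) * t0 D ≤ bigP D ^ (0.004 : ℝ) := D_mul_t0_le_rpow hℓ5
  have hP4 : 0 < bigP D ^ (0.004 : ℝ) := Real.rpow_pos_of_pos hP _
  have hP496 : 0 < bigP D ^ (0.496 : ℝ) := Real.rpow_pos_of_pos hP _
  have hPsplit : bigP D ^ (0.496 : ℝ) * bigP D ^ (0.004 : ℝ) = bigP D ^ (0.5 : ℝ) := by
    rw [← Real.rpow_add hP]; norm_num
  -- the cut point `W = P^{0.496}·Dt₀/T`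
  obtain ⟨W, hW⟩ : ∃ W : ℝ, W = bigP D ^ (0.496 : ℝ) * ((D : ℝ) * t0 D) / bigT D := ⟨_, rfl⟩
  have hPT : bigT D ≤ bigP D ^ (0.496 : ℝ) := bigT_le_rpow496 hℓ3
  have hW1 : 1 ≤ W := by
    rw [hW, le_div_iff₀ hT0, one_mul]
    calc bigT D ≤ bigP D ^ (0.496 : ℝ) * 1 := by rw [mul_one]; exact hPT
      _ ≤ bigP D ^ (0.496 : ℝ) * ((D : ℝ) * t0 D) := by gcongr
  -- `y* = yShift D n` on the range
  have hys : ∀ n : ℕ, yShift D n = (n : ℝ) * bigP D ^ (0.004 : ℝ) / ((D : ℝ) * t0 D) := fun n => rfl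
  have hy1 : ∀ n : ℕ, 1 ≤ n → 1 ≤ yShift D n := by
    intro n hn
    rw [hys, le_div_iff₀ hDt0, one_mul]
    calc (D : ℝ) * t0 D ≤ bigP D ^ (0.004 : ℝ) := hDtP
      _ = 1 * bigP D ^ (0.004 : ℝ) := (one_mul _).symm
      _ ≤ (n : ℝ) * bigP D ^ (0.004 : ℝ) := by gcongr; exact_mod_cast hn
  have hy5 : ∀ n : ℕ, (n : ℝ) < bigP D ^ (0.496 : ℝ) → yShift D n ≤ bigP D ^ (0.5 : ℝ) := by
    intro n hn
    rw [hys, div_le_iff₀ hDt0, ← hPsplit]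
    calc (n : ℝ) * bigP D ^ (0.004 : ℝ) ≤ bigP D ^ (0.496 : ℝ) * bigP D ^ (0.004 : ℝ) := by
          gcongr
      _ = bigP D ^ (0.496 : ℝ) * bigP D ^ (0.004 : ℝ) * 1 := (mul_one _).symm
      _ ≤ bigP D ^ (0.496 : ℝ) * bigP D ^ (0.004 : ℝ) * ((D : ℝ) * t0 D) := by gcongr
  have hyW : ∀ n : ℕ, (n : ℝ) ≤ W → yShift D n ≤ bigP D ^ (0.5 : ℝ) / bigT D := by
    intro n hn
    rw [hys, div_le_iff₀ hDt0, div_mul_eq_mul_div, le_div_iff₀ hT0, ← hPsplit]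
    rw [hW, le_div_iff₀ hT0] at hn
    calc (n : ℝ) * bigP D ^ (0.004 : ℝ) * bigT D = (n : ℝ) * bigT D * bigP D ^ (0.004 : ℝ) := by ring
      _ ≤ bigP D ^ (0.496 : ℝ) * ((D : ℝ) * t0 D) * bigP D ^ (0.004 : ℝ) := by gcongr
      _ = bigP D ^ (0.496 : ℝ) * bigP D ^ (0.004 : ℝ) * ((D : ℝ) * t0 D) := by ring
  have hyW' : ∀ n : ℕ, ¬ (n : ℝ) ≤ W → bigP D ^ (0.5 : ℝ) / bigT D < yShift D n := by
    intro n hn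
    have hn' : W < n := not_le.mp hn
    rw [hys, lt_div_iff₀ hDt0, div_mul_eq_mul_div, div_lt_iff₀ hT0, ← hPsplit]
    rw [hW, div_lt_iff₀ hT0] at hn'
    calc bigP D ^ (0.496 : ℝ) * bigP D ^ (0.004 : ℝ) * ((D : ℝ) * t0 D)
        = bigP D ^ (0.496 : ℝ) * ((D : ℝ) * t0 D) * bigP D ^ (0.004 : ℝ) := by ring
      _ < (n : ℝ) * bigT D * bigP D ^ (0.004 : ℝ) := by gcongr
      _ = (n : ℝ) * bigP D ^ (0.004 : ℝ) * bigT D := by ring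
  -- the `m`-sum bound per `n`
  have hMmain : ∀ n : ℕ, 1 ≤ n → (n : ℝ) < bigP D ^ (0.496 : ℝ) → (n : ℝ) ≤ W →
      ‖frakv1 c' χ j (yShift D n)‖ ≤ C1' * bigT D ^ (-c) := by
    intro n hn _ hnW
    exact ((H1D (yShift D n)).1 (hy1 n hn) (hyW n hnW)).trans
      (mul_le_mul_of_nonneg_right hC11 (Real.rpow_nonneg hT0.le _))
  have hMwin : ∀ n : ℕ, 1 ≤ n → (n : ℝ) < bigP D ^ (0.496 : ℝ) → ¬ (n : ℝ) ≤ W →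
      ‖frakv1 c' χ j (yShift D n)‖ ≤ C1' * (ell D ^ 7)⁻¹ := by
    intro n hn hnP hnW
    exact ((H1D (yShift D n)).2.2.2 (Or.inl ⟨hyW' n hnW, hy5 n hnP⟩)).trans
      (mul_le_mul_of_nonneg_right hC11 (by positivity))
  -- the `n`-sum bound per `(n/r, r)`: `‖N‖ ≤ (n/φ(n))⁴·K_N·𝓛⁻⁷`
  have hG : ∀ μ : ℕ, ∀ y : ℝ, |Real.log y| ≤ ell D ^ 9 → ‖frakgW c' D j μ y‖ ≤ G0 := by
    intro μ y hy
    rw [hG0def]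
    exact Section9Discharge.norm_frakgW_le (c' := c') h1 j μ hy
  have h504N := Sec10B.rpow504_le_nsuppBound hℓ3
  have hN : ∀ n : ℕ, 1 ≤ n → (n : ℝ) < bigP D ^ (0.496 : ℝ) → ∀ r ∈ n.divisors,
      ‖Sec10C.nSum22 c' χ j (n / r) r‖ ≤
        ((n : ℝ) / Nat.totient n) ^ 2 * (((n : ℝ) / Nat.totient n) ^ 2 * (KN / ell D ^ 7)) := by
    intro n hn hnP r hr
    have hrn : r ∣ n := Nat.dvd_of_mem_divisors hr
    have hr1 : 1 ≤ r := Nat.pos_of_mem_divisors hr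
    have hdr : n / r * r = n := Nat.div_mul_cancel hrn
    have hd1 : 1 ≤ n / r := Nat.div_pos (Nat.le_of_dvd hn hrn) hr1
    have hdrR : ((n / r * r : ℕ) : ℝ) = n := by rw [hdr]
    have hdrP : ((n / r * r : ℕ) : ℝ) < bigP D ^ (0.496 : ℝ) := by rw [hdrR]; exact hnP
    have hdrN : ((n / r * r : ℕ) : ℝ) < bigP D / bigT D ^ 2 := by
      rw [hdrR]
      exact hnP.trans_le ((Real.rpow_le_rpow_of_exponent_le hP1.le (by norm_num)).trans h504N)
    -- the relative factor `(∏_{q∣n}(1−q⁻¹)⁻¹)² = (n/φ(n))²`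
    set ρ : ℝ := (n : ℝ) / Nat.totient n with hρ
    have hρ1 : 1 ≤ ρ := one_le_self_div_totient (by omega)
    have hρ2 : 1 ≤ ρ ^ 2 := one_le_pow₀ hρ1
    have hprod : (∏ q ∈ (n / r * r).primeFactors, (1 - (q : ℝ)⁻¹)⁻¹) ^ 2 = ρ ^ 2 := by
      rw [hdr, prod_one_sub_inv_inv_eq_ratio (by omega)]
    -- the relative Lemma 8.4 at the two points
    obtain ⟨hy3T, hy3P⟩ := P3_div_window hℓ3 hn hnP
    obtain ⟨hy2T, hy2P⟩ := P2_div_window hℓ4 hn hnP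
    rw [← hdrR] at hy3T hy3P hy2T hy2P
    have h6 := H4D 6 (by simp) (n / r) r hd1 hr1 hdrN _ hy3T hy3P
    have h7 := H4D 7 (by simp) (n / r) r hd1 hr1 hdrN _ hy2T hy2P
    rw [hprod] at h6 h7
    have hcoef : C4 * (ell D ^ 6)⁻¹ * ρ ^ 2 ≤ C4' * ρ ^ 2 * (ell D ^ 6)⁻¹ := by
      calc C4 * (ell D ^ 6)⁻¹ * ρ ^ 2 = C4 * ρ ^ 2 * (ell D ^ 6)⁻¹ := by ring
        _ ≤ C4' * ρ ^ 2 * (ell D ^ 6)⁻¹ := by gcongr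
    have hw6 := h6.trans hcoef
    have hw7 := h7.trans hcoef
    have key := norm_nSum22_le c' χ hℓ4 hp (C84 := C4' * ρ ^ 2) (by positivity) hG0 j hG hd1 hr1
      hdrP hw6 hw7
    rw [hdr] at key
    calc ‖Sec10C.nSum22 c' χ j (n / r) r‖
        ≤ ρ ^ 2 * ((5 / 4 / 0.498 + 23 / 10 / 0.4) * (4 * Real.exp (9 / 2) * G0 + C4' * ρ ^ 2)) /
            ell D ^ 7 := by exact_mod_cast key
      _ ≤ ρ ^ 2 * ((5 / 4 / 0.498 + 23 / 10 / 0.4) *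
            (4 * Real.exp (9 / 2) * G0 * ρ ^ 2 + C4' * ρ ^ 2)) / ell D ^ 7 := by
          have hG' : 4 * Real.exp (9 / 2) * G0 ≤ 4 * Real.exp (9 / 2) * G0 * ρ ^ 2 :=
            le_mul_of_one_le_right (by positivity) hρ2
          have hl7 : 0 < ell D ^ 7 := by positivity
          refine div_le_div_of_nonneg_right ?_ hl7.le
          refine mul_le_mul_of_nonneg_left ?_ (by positivity)
          refine mul_le_mul_of_nonneg_left ?_ (by norm_num)
          linarith
      _ = ρ ^ 2 * (ρ ^ 2 * (KN / ell D ^ 7)) := by rw [hKN]; ring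
  -- the `m`-sum per `(n/r, r)` is `𝔳₁ⱼ(y*(n))`
  have hMeq : ∀ n : ℕ, 1 ≤ n → ∀ r ∈ n.divisors,
      Sec10C.mSum14 c' χ j (n / r) r = frakv1 c' χ j (yShift D n) := by
    intro n hn r hr
    have hrn : r ∣ n := Nat.dvd_of_mem_divisors hr
    have hr1 : 1 ≤ r := Nat.pos_of_mem_divisors hr
    have hd1 : 1 ≤ n / r := Nat.div_pos (Nat.le_of_dvd hn hrn) hr1
    rw [Sec10C.mSum14_eq_frakv1_yShift c' χ hℓ3 j hd1 hr1, Nat.div_mul_cancel hrn]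
  -- assemble
  set F : Finset ℕ := (Finset.Ico 1 (Nsupp D)).filter
    (fun n : ℕ => (0 : ℝ) ≤ (n : ℝ) ∧ (n : ℝ) < bigP D ^ (0.496 : ℝ)) with hF
  have hFmem : ∀ n ∈ F, 1 ≤ n ∧ (n : ℝ) < bigP D ^ (0.496 : ℝ) := by
    intro n hn
    rw [hF, Finset.mem_filter, Finset.mem_Ico] at hn
    exact ⟨hn.1.1, hn.2.2⟩
  -- per-`n` bound with the two-valued `M`, weight `(n/φ(n))⁹`
  have hper : ∀ n ∈ F, ∑ r ∈ n.divisors, ‖term1422 c' χ j (n / r) r‖ ≤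
      ((n : ℝ) / Nat.totient n) ^ 9 / n *
        (if (n : ℝ) ≤ W then C1' * bigT D ^ (-c) else C1' * (ell D ^ 7)⁻¹) * (KN / ell D ^ 7) := by
    intro n hn
    obtain ⟨hn1, hnP⟩ := hFmem n hn
    calc ∑ r ∈ n.divisors, ‖term1422 c' χ j (n / r) r‖
        ≤ ((n : ℝ) / Nat.totient n) ^ 7 / n *
            (if (n : ℝ) ≤ W then C1' * bigT D ^ (-c) else C1' * (ell D ^ 7)⁻¹) *
            (((n : ℝ) / Nat.totient n) ^ 2 * (KN / ell D ^ 7)) := by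
          refine sum_divisors_term1422_le c' χ j (by omega) (by split_ifs <;> positivity)
            (fun r hr => ?_) (hN n hn1 hnP)
          rw [hMeq n hn1 r hr]
          split_ifs with hnW
          · exact hMmain n hn1 hnP hnW
          · exact hMwin n hn1 hnP hnW
      _ = ((n : ℝ) / Nat.totient n) ^ 9 / n *
            (if (n : ℝ) ≤ W then C1' * bigT D ^ (-c) else C1' * (ell D ^ 7)⁻¹) *
            (KN / ell D ^ 7) := by
          ring
  have hS : ‖S1422On c' χ j 0 (bigP D ^ (0.496 : ℝ))‖ ≤
      C1' * bigT D ^ (-c) * (KN / ell D ^ 7) * (1 + Real.exp 1024 * (1 + Real.log W)) +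
        C1' * (ell D ^ 7)⁻¹ * (KN / ell D ^ 7) *
          (Real.exp 1024 * (1 + 2 * Real.log 2 +
            max 0 (Real.log (bigP D ^ (0.496 : ℝ)) - Real.log W))) := by
    rw [S1422On_low_eq c' χ hℓ3 j, ← hF]
    calc ‖∑ n ∈ F, ∑ r ∈ n.divisors, term1422 c' χ j (n / r) r‖
        ≤ ∑ n ∈ F, ‖∑ r ∈ n.divisors, term1422 c' χ j (n / r) r‖ := norm_sum_le _ _
      _ ≤ ∑ n ∈ F, ∑ r ∈ n.divisors, ‖term1422 c' χ j (n / r) r‖ :=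
          Finset.sum_le_sum fun n _ => norm_sum_le _ _
      _ ≤ ∑ n ∈ F, ((n : ℝ) / Nat.totient n) ^ 9 / n *
            (if (n : ℝ) ≤ W then C1' * bigT D ^ (-c) else C1' * (ell D ^ 7)⁻¹) *
              (KN / ell D ^ 7) := Finset.sum_le_sum hper
      _ = C1' * bigT D ^ (-c) * (KN / ell D ^ 7) *
              ∑ n ∈ F.filter (fun n : ℕ => (n : ℝ) ≤ W), ((n : ℝ) / Nat.totient n) ^ 9 / n +
            C1' * (ell D ^ 7)⁻¹ * (KN / ell D ^ 7) *
              ∑ n ∈ F.filter (fun n : ℕ => ¬ (n : ℝ) ≤ W), ((n : ℝ) / Nat.totient n) ^ 9 / n := by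
          rw [← Finset.sum_filter_add_sum_filter_not F (fun n : ℕ => (n : ℝ) ≤ W), Finset.mul_sum,
            Finset.mul_sum]
          congr 1
          · refine Finset.sum_congr rfl fun n hn => ?_
            rw [Finset.mem_filter] at hn
            rw [if_pos hn.2]; ring
          · refine Finset.sum_congr rfl fun n hn => ?_
            rw [Finset.mem_filter] at hn
            rw [if_neg hn.2]; ring
      _ ≤ _ := by
          gcongr
          · exact sum_main_le9 F (fun n hn => (hFmem n hn).1) hW1
          · exact sum_window_le9 F (Real.one_le_rpow hP1.le (by norm_num)) hFmem hW1
  -- sizes of the logarithms involved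
  have hαeq : alpha D = π / ell D ^ 9 := by rw [alpha, log_bigP]
  have hlogW : Real.log W =
      0.496 * ell D ^ 9 + Real.log ((D : ℝ) * t0 D) - ell D ^ (1.1 : ℝ) := by
    rw [hW, Real.log_div (by positivity) hT0.ne', Real.log_mul hP496.ne' hDt0.ne', log_bigP_rpow,
      log_bigT]
  have hlogDt0 : 0 ≤ Real.log ((D : ℝ) * t0 D) := Real.log_nonneg hDt1
  have hlogDt : Real.log ((D : ℝ) * t0 D) ≤ 520 * ell D := by
    have h := Real.log_le_log hDt0 (D_mul_t0_le h1)
    rwa [Real.log_exp] at h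
  have h520 := aux520 hℓ5
  have hrp0 : 0 ≤ ell D ^ (1.1 : ℝ) := Real.rpow_nonneg h0.le _
  have hW9 : Real.log W ≤ ell D ^ 9 := by rw [hlogW]; linarith
  have hW9' : 1 + Real.log W ≤ 1 + ell D ^ 9 := by linarith
  have hmax : max 0 (Real.log (bigP D ^ (0.496 : ℝ)) - Real.log W) ≤ ell D ^ 2 := by
    rw [max_le_iff, log_bigP_rpow, hlogW]
    have h11 := ell_rpow_le_sq h1
    constructor
    · positivity
    · linarith
  have hwin : 1 + 2 * Real.log 2 + max 0 (Real.log (bigP D ^ (0.496 : ℝ)) - Real.log W) ≤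
      3 + ell D ^ 2 := by linarith [one_add_two_log_two_le]
  have hTc : bigT D ^ (-c) ≤ Real.exp (-(c * ell D)) := by
    rw [bigT, ← Real.exp_mul, Real.exp_le_exp]
    have h := mul_le_mul_of_nonneg_left (ell_le_rpow h1) hc.le
    linarith
  have hE1 : (1 : ℝ) ≤ Real.exp 1024 := Real.one_le_exp (by norm_num)
  have hL9 : (1 : ℝ) ≤ ell D ^ 9 := one_le_pow₀ h1
  have hmainpoly := one_add_mul_le_three hE1 hL9
  have hfin := closing_bound9 (K := C1' * KN) (mul_nonneg hC1'0 hKN0) hc hε h1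
    (by rw [hL1] at hℓL1; exact hℓL1)
  have hl7 : 0 < ell D ^ 7 := by positivity
  calc ‖S1422On c' χ j 0 (bigP D ^ (0.496 : ℝ))‖
      ≤ _ := hS
    _ ≤ C1' * Real.exp (-(c * ell D)) * (KN / ell D ^ 7) * (1 + Real.exp 1024 * (1 + ell D ^ 9)) +
          C1' * (ell D ^ 7)⁻¹ * (KN / ell D ^ 7) * (Real.exp 1024 * (3 + ell D ^ 2)) := by
        have hlogW0 : 0 ≤ Real.log W := Real.log_nonneg hW1
        gcongr
    _ ≤ C1' * Real.exp (-(c * ell D)) * (KN / ell D ^ 7) * (3 * Real.exp 1024 * ell D ^ 9) +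
          C1' * (ell D ^ 7)⁻¹ * (KN / ell D ^ 7) * (Real.exp 1024 * (3 + ell D ^ 2)) := by
        gcongr
    _ = C1' * KN * (3 * Real.exp 1024 * ell D ^ 11 * Real.exp (-(c * ell D)) +
          Real.exp 1024 * (3 + ell D ^ 2) / ell D ^ 5) / ell D ^ 9 := by
        field_simp
    _ ≤ ε * π / ell D ^ 9 := by gcongr
    _ = ε * alpha D := by rw [hαeq]; ring

/-- **Z22:§10.u049 (i) modulo the RELATIVE Lemma 8.4 only** (for the manuscript's parameter range
`c′ ≥ 0`): Lemma 10.1 is a theorem of the tree (sz-d45's `Skeleton.lemma101_holds`), so the low range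
of `S_j(𝐚₁₄,𝐚₂₂)` is `o(α)` as soon as `Skeleton.Lemma84Rel c′` holds — an in-scope term of
`Skeleton.theorem1_of_leaves_v19` (`lemma84Rel_of_lemma83Rel h83`). [cite: Zhang2022LandauSiegel, §10 p. 59] -/
theorem low1422Small_of_lemma84Rel {c' : ℝ} (hc' : 0 ≤ c') (h84 : Lemma84Rel c') :
    Low1422Small c' :=
  low1422Small_of_rel c' (lemma101_holds hc') h84

end Literature.NumberTheory.LFunctions.Zhang2022.Typed.Sec10C
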